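import Summits.AnomalousDissipation.AnomalousDissipation.Theses.BaireTransfer
import Literature.Analysis.FluidPDE.DoeringFoiasProofs
import Literature.Analysis.FluidPDE.DoeringFoiasPowerProofs
import Literature.Analysis.FluidPDE.DoeringFoiasAmplitudeProofs
import Literature.Analysis.FluidPDE.LerayProjectorTorusProofs
import Literature.Analysis.FluidPDE.LongTimeAverageNonneg
import Literature.Analysis.FluidPDE.LerayHopfTimeSliceTorus
import Literature.Analysis.FluidPDE.LongTimeAveragePeriodic
import Literature.Analysis.FunctionSpaces.TorusClassicalNSUniqueness
import Literature.Analysis.FunctionSpaces.TorusCalculusProofs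
import Literature.Analysis.FunctionSpaces.TorusFourierCalculus
import Literature.Analysis.FunctionSpaces.TorusFourierConvolution
import Literature.Analysis.FunctionSpaces.TorusTestFunction
import Literature.Analysis.FluidPDE.EulerReynolds
import Literature.Analysis.FunctionSpaces.TorusFourierModes

/-!
# Disproof work file for the crux `BaireTransfer.RobustLoudUpgrade` (stmt-AnomalousDissipation-1144)

Standing adversary (cdisprove), generation 3.  Prose lives only in docstrings; every `theorem` is
checked (`lean check` rc 0, no `sorry` unless marked NEAR-MISS).

## Index of findings (all generations)

see the bottom `VERDICT` docblock; sections: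

* §1 restatement `loud`, `crux_iff`, exact kill shape `not_crux_iff`, local kill shape;
* §2 the force map `c ↦ f_c` (linear, smooth, divergence free, mean zero, `L²`);
* §3 ν-uniform POWER BOUND `ε ≤ ‖f_c‖₂ √E` on `LOUD` and corollaries;
* §5 the Doering–Foias BUDGET LAW `‖f_c‖₂² ≤ C E + a K √E` on `LOUD` and the VISCOSITY FLOOR of
  low-energy witnesses (the only compact census window);
* §4 kill TEMPLATES (meagre confinement / hyperplane confinement) and why the available
  instances are vacuous for this crux;
* §6 NON-VACUITY and TIGHTNESS: the laminar shear witness `cLam A ∈ LOUD` in every `P_S` with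
  `k₀ = (0,1,0) ∈ S` (exact classical steady solution), power bound saturated, the quiet ray
  `θ • cLam A` (`θ<1`), `LOUD` not open (strengthening `interior` for `closure ∘ interior` FALSE);
* §7 BOOKKEEPING: stocks monotone (`upgradeWith_mono`), zero-extension `P_S ↪ P_{S'}` preserves
  `LOUD` (`mem_loud_iff_extend`) but NOT interiors (caveat), relaxation constants monotone;
* §8 LOAD-BEARING `0 < ε`: `crux_false_without_pos_budget` — with `ε > 0` dropped the crux is
  FALSE for every stock (`LOUD(S,0,0) ⊆ ker (c ↦ f_c) ∌ cLam 1`, `0 ∈ LOUD(S,0,0)`);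
* §9 LEVEL IS DECORATION: `crux_iff_levelZero` (scale covariance of `LOUD` along `c ↦ α²c`; the
  time-rescaling lemmas are vendored from the sibling work file `Cruxes/DenseLoudDesignerForces`);
* §10 NEW A-PRIORI LAW, the VISCOSITY CEILING: `viscosity_ceiling` (`ν·⟨ν‖∇u‖²⟩ ≤ ‖f_c‖₂²/(4π²)` for
  every periodic classical witness), `loudAt_viscosity_le` (`ν ≤ ‖f_c‖₂²/(4π²ε)` on `LOUD`),
  `mem_loud_of_fnorm_sq_lt` (the level ceiling is inactive for `‖f_c‖₂² < 4π²εa'`);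
* §11 NEW: PHASE (lattice-translation) INVARIANCE — `force_phase`, `translate_isClassical`,
  `mem_loud_iff_phase`, `mem_interior_loud_iff_phase`, `mem_closure_interior_loud_iff_phase` (the
  `loud_translate` the crux cards lean on, proved; `LOUD`, its interior and the obligation are `T³`-invariant).
-/

set_option linter.dupNamespace false

noncomputable section

open scoped BigOperators Topology InnerProductSpace RealInnerProductSpace ENNReal
open Filter Set Function TopologicalSpace MeasureTheory

namespace Summit.AnomalousDissipation.AnomalousDissipation.Cruxes.RobustLoudUpgrade.Disproof

open Literature.Analysis.FunctionSpaces Literature.Analysis.FunctionSpaces.Torus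
open Literature.Analysis.FluidPDE
open Summit.AnomalousDissipation.AnomalousDissipation.Theses.BaireTransfer

/-- The flat unit torus `T³`. -/
local notation "𝕋³" => UnitAddTorus (Fin 3)
/-- Real velocity values. -/
local notation "ℝ³" => EuclideanSpace ℝ (Fin 3)
/-- Complex Fourier coefficients. -/
local notation "ℂ³" => EuclideanSpace ℂ (Fin 3)

/-! ## §1 Restatement and the exact kill shape -/

/-- The parameter space `P_S = (↥S → ℂ³)` of coefficient vectors (sup norm, finite dimensional,
complete, hence Baire). [folklore] -/
abbrev Coeff (S : Finset (Fin 3 → ℤ)) : Type := ↥S → ℂ³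

/-- The steady trigonometric-polynomial force `f_c = realTrigPoly S (k ↦ P_k ĉ_k)` parametrised by
`c ∈ P_S` (verbatim the force of the route file). [folklore] -/
def force (S : Finset (Fin 3 → ℤ)) (c : Coeff S) : 𝕋³ → ℝ³ :=
  realTrigPoly S (fun k => Torus.lerayCoeff k (coeffExt S c k))

/-- `LOUD^{(0,a)}(S,E,ε)`: coefficient vectors `c` carrying, at SOME viscosity `ν ∈ (0,a)`, a
time-periodic classical solution of NS_ν on `ℝ × T³` forced by `f_c` with mean energy `≤ E` and
mean dissipation `≥ ε` (the route's `LOUD_j` is `a = 1/(j+1)`). [folklore] -/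
def loud (S : Finset (Fin 3 → ℤ)) (a E ε : ℝ) : Set (Coeff S) :=
  {c | ∃ ν : ℝ, 0 < ν ∧ ν < a ∧ ∃ (τ : ℝ) (u : ℝ → 𝕋³ → ℝ³) (p : ℝ → 𝕋³ → ℝ), 0 < τ ∧
    IsClassicalNSSolutionOn Set.univ ν (fun _ => force S c) u p ∧ Function.Periodic u τ ∧
      meanEnergy u ≤ E ∧ ε ≤ meanDissipation ν u}

/-- The viscosity ceiling of level `j`. [folklore] -/
abbrev ceil (j : ℕ) : ℝ := 1 / ((j : ℝ) + 1)

/-- **The crux, restated** (definitional): `∃ S₀ ∀ S ⊇ S₀ ∀ E ε, 0 < ε → ∀ j,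
LOUD_j(S,E,ε) ⊆ closure (interior LOUD_j(S,2E,ε/2))`. [folklore] -/
theorem crux_iff :
    RobustLoudUpgrade ↔
      ∃ S₀ : Finset (Fin 3 → ℤ), ∀ S : Finset (Fin 3 → ℤ), S₀ ⊆ S → ∀ (E ε : ℝ), 0 < ε →
        ∀ j : ℕ, loud S (ceil j) E ε ⊆ closure (interior (loud S (ceil j) (2 * E) (ε / 2))) :=
  Iff.rfl

/-- **Exact kill shape** (negation of the crux, pure logic): for EVERY finite stock `S₀` one must
produce `S ⊇ S₀`, budgets `E`, `ε > 0`, a level `j` and a loud `c` which is NOT in the closure of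
the robustly (relaxed-)loud set. [folklore] -/
theorem not_crux_iff :
    ¬ RobustLoudUpgrade ↔
      ∀ S₀ : Finset (Fin 3 → ℤ), ∃ S : Finset (Fin 3 → ℤ), S₀ ⊆ S ∧ ∃ (E ε : ℝ), 0 < ε ∧
        ∃ j : ℕ, ∃ c ∈ loud S (ceil j) E ε,
          c ∉ closure (interior (loud S (ceil j) (2 * E) (ε / 2))) := by
  rw [crux_iff]
  push Not
  simp only [Set.not_subset]

/-- **Local kill shape** (pure topology): `c ∉ closure (interior A)` iff some neighbourhood of `c`
is disjoint from `interior A`, i.e. iff the complement `Aᶜ` ("quiet forces") is dense near `c`.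
[folklore] -/
theorem not_mem_closure_interior_iff {X : Type*} [TopologicalSpace X] {A : Set X} {c : X} :
    c ∉ closure (interior A) ↔ ∃ V ∈ 𝓝 c, Disjoint V (interior A) := by
  rw [mem_closure_iff_nhds]
  push Not
  simp only [Set.disjoint_iff_inter_eq_empty]

/-- The same in "dense quiet" form: an OPEN `V ∋ c` in which the quiet set `Aᶜ` is dense
(`V ⊆ closure Aᶜ`) certifies `c ∉ closure (interior A)`. [folklore] -/
theorem not_mem_closure_interior_of_dense_compl {X : Type*} [TopologicalSpace X] {A V : Set X}
    {c : X} (hV : IsOpen V) (hc : c ∈ V) (hq : V ⊆ closure Aᶜ) :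
    c ∉ closure (interior A) := by
  rw [not_mem_closure_interior_iff]
  refine ⟨V, hV.mem_nhds hc, Set.disjoint_left.2 fun x hxV hxA => ?_⟩
  have hx : x ∈ closure Aᶜ := hq hxV
  rw [closure_compl] at hx
  exact hx hxA

/-! ## §2 The force map -/

section Force

variable {S : Finset (Fin 3 → ℤ)}

/-- The Leray multiplier is `ℂ`-homogeneous. [folklore] -/
theorem lerayCoeff_smul (k : Fin 3 → ℤ) (a : ℂ) (v : ℂ³) :
    Torus.lerayCoeff k (a • v) = a • Torus.lerayCoeff k v := by
  by_cases hk : k = 0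
  · subst hk; simp
  · rw [Torus.lerayCoeff_of_ne_zero hk, Torus.lerayCoeff_of_ne_zero hk, Torus.leraySym_smul]

/-- The coefficient family of `f_c`. [folklore] -/
def forceCoeff (S : Finset (Fin 3 → ℤ)) (c : Coeff S) : (Fin 3 → ℤ) → ℂ³ :=
  fun k => Torus.lerayCoeff k (coeffExt S c k)

theorem force_eq (c : Coeff S) : force S c = realTrigPoly S (forceCoeff S c) := rfl

theorem forceCoeff_add (c c' : Coeff S) : forceCoeff S (c + c') = forceCoeff S c + forceCoeff S c' := by
  funext k
  simp [forceCoeff, coeffExt_add, Torus.lerayCoeff_add]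

theorem forceCoeff_smul (a : ℝ) (c : Coeff S) : forceCoeff S (a • c) = (a : ℂ) • forceCoeff S c := by
  funext k
  simp only [forceCoeff, Pi.smul_apply]
  rw [← lerayCoeff_smul]
  congr 1
  by_cases hk : k ∈ S
  · simp [coeffExt, hk, Complex.coe_smul]
  · simp [coeffExt, hk]

/-- The zero mode of `f_c` vanishes (`lerayCoeff 0 = 0`): the force is automatically mean zero. [folklore] -/
@[simp] theorem forceCoeff_zero_freq (c : Coeff S) : forceCoeff S c 0 = 0 := by
  simp [forceCoeff]

/-- `c ↦ f_c` is additive. [folklore] -/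
theorem force_add (c c' : Coeff S) : force S (c + c') = force S c + force S c' := by
  rw [force_eq, force_eq, force_eq, forceCoeff_add, realTrigPoly_add]

/-- `c ↦ f_c` is `ℝ`-homogeneous. [folklore] -/
theorem force_smul (a : ℝ) (c : Coeff S) : force S (a • c) = a • force S c := by
  funext x
  ext i
  rw [force_eq, force_eq, forceCoeff_smul]
  simp only [realTrigPoly_apply_coord, trigPoly_apply_coord, Pi.smul_apply, PiLp.smul_apply,
    smul_eq_mul]
  have hsum : (∑ k ∈ S, UnitAddTorus.mFourier k x * ((a : ℂ) * forceCoeff S c k i)) =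
      (a : ℂ) * ∑ k ∈ S, UnitAddTorus.mFourier k x * forceCoeff S c k i := by
    rw [Finset.mul_sum]
    exact Finset.sum_congr rfl fun k _ => by ring
  rw [hsum, Complex.re_ofReal_mul]

/-- `f_0 = 0`. [folklore] -/
@[simp] theorem force_zero : force S (0 : Coeff S) = 0 := by
  have h := force_smul (S := S) 0 0
  rwa [zero_smul, zero_smul] at h

/-- `c ↦ f_c` as an `ℝ`-linear map into fields. [folklore] -/
def forceₗ (S : Finset (Fin 3 → ℤ)) : Coeff S →ₗ[ℝ] (𝕋³ → ℝ³) where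
  toFun := force S
  map_add' := force_add
  map_smul' := force_smul

/-- `f_c` is smooth. [folklore] -/
theorem isSmooth_force (c : Coeff S) : IsSmooth (force S c) := isSmooth_realTrigPoly _ _

/-- `f_c` is divergence free (the Leray multiplier makes every coefficient transversal). [folklore] -/
theorem isDivFree_force (c : Coeff S) : IsDivFree (force S c) := by
  refine isDivFree_realTrigPoly fun k _ => ?_
  by_cases hk : k = 0
  · subst hk; simp
  · show ∑ j, (k j : ℂ) * forceCoeff S c k j = 0
    simp only [forceCoeff, Torus.lerayCoeff_of_ne_zero hk]
    exact Torus.sum_mul_leraySym_apply k _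

/-- `f_c` has zero mean (its zero Fourier mode is `lerayCoeff 0 _ = 0`). This closes the cheapest
conceivable kill ("a nonzero mean force admits no periodic orbit at all, so `LOUD` would sit in a
hyperplane", §4): the parametrisation never produces a mean. [folklore] -/
theorem hasZeroMean_force (c : Coeff S) : HasZeroMean (force S c) := by
  unfold HasZeroMean
  rw [force_eq]
  simp only [realTrigPoly_apply]
  have hint : Integrable (trigPoly S (forceCoeff S c)) volume :=
    (continuous_trigPoly S _).integrable_unitAddTorus
  rw [ContinuousLinearMap.integral_comp_comm _ hint]
  have h0 : ∫ x, trigPoly S (forceCoeff S c) x = 0 := by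
    simp only [trigPoly_apply]
    rw [integral_finsetSum S (f := fun k x => UnitAddTorus.mFourier k x • forceCoeff S c k) fun k _ =>
      ((UnitAddTorus.mFourier k).continuous.smul continuous_const).integrable_unitAddTorus]
    refine Finset.sum_eq_zero fun k _ => ?_
    rw [integral_smul_const, integral_mFourier]
    by_cases hk : k = 0
    · subst hk; simp
    · simp [hk]
  rw [h0, map_zero]

/-- `f_c ∈ L^p` for every `p`. [folklore] -/
theorem memLp_force (c : Coeff S) (q : ℝ≥0∞) : MemLp (force S c) q volume := memLp_realTrigPoly _ _ q

/-- `f_c` is continuous. [folklore] -/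
theorem continuous_force (c : Coeff S) : Continuous (force S c) := continuous_realTrigPoly _ _

end Force

/-! ## §3 The ν-uniform power bound on `LOUD` and corollaries -/

section Power

variable {S : Finset (Fin 3 → ℤ)} {a E ε : ℝ} {c : Coeff S}

/-- The `L²` norm `‖f_c‖₂`. [folklore] -/
def fnorm (S : Finset (Fin 3 → ℤ)) (c : Coeff S) : ℝ := Real.sqrt (∫ x, ‖force S c x‖ ^ 2)

theorem fnorm_nonneg (c : Coeff S) : 0 ≤ fnorm S c := Real.sqrt_nonneg _

@[simp] theorem fnorm_zero : fnorm S (0 : Coeff S) = 0 := by simp [fnorm]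

/-- **Power bound, ν-uniform** (Doering–Foias / Cheskidov–Doering–Petrov eq. (11), (17), all in
tree): every loud witness satisfies `ε ≤ meanDissipation ≤ ⟨f_c·u⟩ ≤ ‖f_c‖₂ √(meanEnergy) ≤ ‖f_c‖₂ √E`.
The classical periodic solution is a global Leray–Hopf solution from its time-zero slice
(`IsClassicalNSSolutionOn.isGlobalLerayHopf`). No `ν` enters the bound. [cite: CheskidovDoeringPetrov2006, eq. (17)] -/
theorem power_bound (h : c ∈ loud S a E ε) : ε ≤ fnorm S c * Real.sqrt E := by
  obtain ⟨ν, hν, -, τ, u, p, -, hsol, -, hE, hε⟩ := h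
  have hLH := hsol.isGlobalLerayHopf
  have h1 : meanDissipation ν u ≤ meanPower (force S c) u :=
    DoeringFoias2002_dissipation_le_power_holds hν (memLp_force c 2) (hasZeroMean_force c) (u 0) u hLH
  have h2 : meanPower (force S c) u ≤ fnorm S c * rmsVelocity longTimeAvgSup u :=
    hLH.meanPower_le hν (isSmooth_force c) (hasZeroMean_force c)
  rw [rmsVelocity_eq_sqrt_meanEnergy] at h2
  have h3 : Real.sqrt (meanEnergy u) ≤ Real.sqrt E := Real.sqrt_le_sqrt hE
  calc ε ≤ meanDissipation ν u := hε
    _ ≤ fnorm S c * Real.sqrt (meanEnergy u) := h1.trans h2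
    _ ≤ fnorm S c * Real.sqrt E := mul_le_mul_of_nonneg_left h3 (fnorm_nonneg c)

/-- Loud witnesses have nonnegative energy budget: `meanEnergy ≥ 0`. [folklore] -/
theorem energy_nonneg_of_mem_loud (h : c ∈ loud S a E ε) : 0 ≤ E := by
  obtain ⟨ν, -, -, τ, u, p, -, -, -, hE, -⟩ := h
  exact (meanEnergy_nonneg u).trans hE

/-- **`LOUD(S,E,ε) = ∅` for `E ≤ 0 < ε`** (power bound with `√E = 0`). In particular the crux is
vacuous (trivially true) at nonpositive energy budgets. [folklore] -/
theorem loud_eq_empty_of_nonpos (hE : E ≤ 0) (hε : 0 < ε) : loud S a E ε = ∅ := by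
  ext c
  simp only [Set.mem_empty_iff_false, iff_false]
  intro h
  have := power_bound h
  rw [Real.sqrt_eq_zero'.2 hE, mul_zero] at this
  exact absurd this (not_le.2 hε)

/-- **`0 ∉ LOUD`** for `ε > 0`: the unforced system carries no loud periodic orbit (power bound with
`f_0 = 0`; dynamically: every periodic classical solution of unforced NS is a constant velocity). [folklore] -/
theorem zero_not_mem_loud (hε : 0 < ε) : (0 : Coeff S) ∉ loud S a E ε := fun h => by
  have := power_bound h
  rw [fnorm_zero, zero_mul] at this
  exact absurd this (not_le.2 hε)

/-- **Quiet cone below the power threshold**: `‖f_c‖₂ √E < ε ⇒ c ∉ LOUD(S,E,ε)` at EVERY level.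
With SHARP budgets this is attained (laminar ray, generation 1: `θ • c_lam`, `θ < 1`, is quiet while
`c_lam` is loud), so `LOUD` is not open and the strengthening "interior instead of
closure ∘ interior" is false; with the RELAXED budgets `(2E, ε/2)` the threshold drops by `2√2`, and
no a-priori (continuous-in-`c`) region can separate `c` from its neighbours — see VERDICT. [folklore] -/
theorem not_mem_loud_of_power_lt (h : fnorm S c * Real.sqrt E < ε) : c ∉ loud S a E ε :=
  fun hc => absurd (power_bound hc) (not_le.2 h)

/-- Monotonicity of `LOUD` in the budgets and the ceiling. [folklore] -/
theorem loud_mono {a a' E E' ε ε' : ℝ} (ha : a ≤ a') (hE : E ≤ E') (hε : ε' ≤ ε) :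
    loud S a E ε ⊆ loud S a' E' ε' := by
  rintro c ⟨ν, hν, hνa, τ, u, p, hτ, hsol, hper, hEu, hεu⟩
  exact ⟨ν, hν, hνa.trans_le ha, τ, u, p, hτ, hsol, hper, hEu.trans hE, hε.trans hεu⟩

/-- The relaxed loud set contains the sharp one (`0 ≤ E` is automatic on `LOUD`, `0 < ε` assumed). [folklore] -/
theorem loud_subset_relaxed (hε : 0 ≤ ε) : loud S a E ε ⊆ loud S a (2 * E) (ε / 2) := by
  intro c hc
  have hE := energy_nonneg_of_mem_loud hc
  exact loud_mono le_rfl (by linarith) (by linarith) hc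

end Power


/-! ## §5 The Doering–Foias budget law on `LOUD` and the viscosity floor of low-energy witnesses -/

section Budget

variable {S : Finset (Fin 3 → ℤ)} {a E ε : ℝ} {c : Coeff S}

theorem fnorm_sq (c : Coeff S) : fnorm S c ^ 2 = ∫ x, ‖force S c x‖ ^ 2 :=
  Real.sq_sqrt (integral_nonneg fun _ => sq_nonneg _)

/-- The `L²`-normalised shape of a nonzero `f_c` as a Doering–Foias `ForcingShape`. [folklore] -/
def shapeOf (c : Coeff S) (hc : fnorm S c ≠ 0) : ForcingShape (Fin 3) where
  shape := force S ((fnorm S c)⁻¹ • c)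
  smooth := isSmooth_force _
  divFree := isDivFree_force _
  zeroMean := hasZeroMean_force _
  sq_norm_eq_one := by
    have hF : 0 < fnorm S c := lt_of_le_of_ne (fnorm_nonneg c) (Ne.symm hc)
    simp_rw [force_smul, Pi.smul_apply, norm_smul, mul_pow, integral_const_mul, Real.norm_eq_abs,
      abs_inv, abs_of_pos hF, ← fnorm_sq, inv_pow]
    exact inv_mul_cancel₀ (pow_ne_zero 2 hc)

theorem shapeOf_force_one (c : Coeff S) (hc : fnorm S c ≠ 0) (F : ℝ) :
    (shapeOf c hc).force 1 F = fun x => F • ((fnorm S c)⁻¹ • force S c x) := by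
  funext x
  simp [ForcingShape.force, shapeOf, force_smul]

theorem shapeOf_force_one_fnorm (c : Coeff S) (hc : fnorm S c ≠ 0) :
    (shapeOf c hc).force 1 (fnorm S c) = force S c := by
  rw [shapeOf_force_one]
  funext x
  rw [smul_smul, mul_inv_cancel₀ hc, one_smul]

/-- **Budget law on `LOUD`, ν-uniform** (Doering–Foias amplitude bound, Cheskidov–Doering–Petrov
eq. (18), in tree as `DoeringFoias.abs_amplitude_le_of_isGlobalLerayHopf`, tested against the force
itself): if `c ∈ LOUD^{(0,a)}(S,E,ε)` and `∑ᵢ‖∂ᵢf_c‖ ≤ C`, `‖Δf_c‖ ≤ K` pointwise, then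
`‖f_c‖₂² ≤ C·E + a·K·√E`.  (`LOUD` is radially BOUNDED modulo `ker (c ↦ f_c)`, generation 2 §3/§5;
with the power bound §3, `LOUD` lives in the shell `ε/√E ≤ ‖f_c‖₂ ≤ (C E + a K √E)^{1/2}`.)
[cite: CheskidovDoeringPetrov2006, §III eq. (18)] -/
theorem budget_law (h : c ∈ loud S a E ε) {C K : ℝ} (hC0 : 0 ≤ C) (hK0 : 0 ≤ K)
    (hC : ∀ x, ∑ i, ‖partialDeriv i (force S c) x‖ ≤ C)
    (hK : ∀ x, ‖laplacian (force S c) x‖ ≤ K) :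
    fnorm S c ^ 2 ≤ C * E + a * K * Real.sqrt E := by
  have hE0 : 0 ≤ E := energy_nonneg_of_mem_loud h
  obtain ⟨ν, hν, hνa, τ, u, p, -, hsol, -, hE, -⟩ := h
  have ha0 : 0 ≤ a := (hν.trans hνa).le
  by_cases hF : fnorm S c = 0
  · rw [hF, zero_pow two_ne_zero]; positivity
  have hFpos : 0 < fnorm S c := lt_of_le_of_ne (fnorm_nonneg c) (Ne.symm hF)
  set Φ := shapeOf c hF with hΦ
  have hu : Torus.IsGlobalLerayHopf ν (fun _ => Φ.force 1 (fnorm S c)) (u 0) u := by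
    rw [shapeOf_force_one_fnorm]; exact hsol.isGlobalLerayHopf
  -- derivative bounds of the normalised shape `Φ.force 1 1 = F⁻¹ • f_c`
  have h11 : Φ.force 1 1 = fun x => (fnorm S c)⁻¹ • force S c x := by
    rw [hΦ, shapeOf_force_one]; funext x; rw [one_smul]
  have hC' : ∀ x, ∑ i, ‖partialDeriv i (Φ.force 1 1) x‖ ≤ C / fnorm S c := fun x => by
    rw [h11]
    simp_rw [Torus.partialDeriv_const_smul_apply, norm_smul, ← Finset.mul_sum, Real.norm_eq_abs,
      abs_inv, abs_of_pos hFpos, div_eq_inv_mul]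
    exact mul_le_mul_of_nonneg_left (hC x) (inv_nonneg.2 hFpos.le)
  have hK' : ∀ x, ‖laplacian (Φ.force 1 1) x‖ ≤ K / fnorm S c := fun x => by
    rw [h11, Torus.laplacian_const_smul (isSmooth_force c), norm_smul, Real.norm_eq_abs, abs_inv,
      abs_of_pos hFpos, div_eq_inv_mul]
    exact mul_le_mul_of_nonneg_left (hK x) (inv_nonneg.2 hFpos.le)
  have hmain := DoeringFoias.abs_amplitude_le_of_isGlobalLerayHopf hν one_pos hu
    (div_nonneg hC0 hFpos.le) (div_nonneg hK0 hFpos.le) hC' hK'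
  rw [abs_of_pos hFpos, rmsVelocity_eq_sqrt_meanEnergy] at hmain
  -- `F ≤ (C/F) U² + ν (K/F) U`  ⇒  `F² ≤ C U² + ν K U ≤ C E + a K √E`
  have hU2 : Real.sqrt (meanEnergy u) ^ 2 ≤ E := by
    rw [Real.sq_sqrt (meanEnergy_nonneg u)]; exact hE
  have hU : Real.sqrt (meanEnergy u) ≤ Real.sqrt E := Real.sqrt_le_sqrt hE
  have h1 : fnorm S c ^ 2 ≤ C * Real.sqrt (meanEnergy u) ^ 2 + ν * K * Real.sqrt (meanEnergy u) := by
    have := mul_le_mul_of_nonneg_left hmain hFpos.le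
    calc fnorm S c ^ 2 = fnorm S c * fnorm S c := sq _
      _ ≤ fnorm S c * (C / fnorm S c * Real.sqrt (meanEnergy u) ^ 2 +
            ν * (K / fnorm S c) * Real.sqrt (meanEnergy u)) := this
      _ = C * Real.sqrt (meanEnergy u) ^ 2 + ν * K * Real.sqrt (meanEnergy u) := by
            field_simp
  calc fnorm S c ^ 2 ≤ C * Real.sqrt (meanEnergy u) ^ 2 + ν * K * Real.sqrt (meanEnergy u) := h1
    _ ≤ C * E + a * K * Real.sqrt E := by gcongr

/-- **Viscosity floor of low-energy loud witnesses** (the budget law solved for `ν`): a loud witness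
of `c` at viscosity `ν` with `meanEnergy ≤ E` obeys `‖f_c‖₂² ≤ C E + ν K √E`, i.e.
`ν ≥ (‖f_c‖₂² − C E)/(K √E)`.  In the LOW-ENERGY regime `C·E < ‖f_c‖₂²` this is a POSITIVE floor:
no loud witness of `c` (nor, by continuity of all constants in `c`, of its neighbours with relaxed
budgets when `C·2E < ‖f_c‖₂²`) exists at small viscosity — the only regime where a census of periodic
orbits is a compact problem (VERDICT (K-window)). Stated in product form to avoid division. [folklore] -/
theorem viscosity_floor {ν : ℝ} (hν : 0 < ν) {τ : ℝ} {u : ℝ → 𝕋³ → ℝ³} {p : ℝ → 𝕋³ → ℝ}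
    (hτ : 0 < τ) (hsol : IsClassicalNSSolutionOn Set.univ ν (fun _ => force S c) u p)
    (hper : Function.Periodic u τ) (hE : meanEnergy u ≤ E) {C K : ℝ} (hC0 : 0 ≤ C) (hK0 : 0 ≤ K)
    (hC : ∀ x, ∑ i, ‖partialDeriv i (force S c) x‖ ≤ C)
    (hK : ∀ x, ‖laplacian (force S c) x‖ ≤ K) :
    fnorm S c ^ 2 - C * E ≤ ν * (K * Real.sqrt E) := by
  -- `c ∈ LOUD^{(0,2ν)}(S,E,ε₀)` with `ε₀ := meanDissipation ν u`, then the budget law with `a = 2ν`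
  -- is too weak by a factor 2; instead rerun it with the ceiling `a ↓ ν`: use `a = ν + δ` for all `δ`.
  have key : ∀ δ : ℝ, 0 < δ → fnorm S c ^ 2 ≤ C * E + (ν + δ) * K * Real.sqrt E := fun δ hδ =>
    budget_law (a := ν + δ) (ε := meanDissipation ν u)
      ⟨ν, hν, by linarith, τ, u, p, hτ, hsol, hper, hE, le_rfl⟩ hC0 hK0 hC hK
  have hlim : fnorm S c ^ 2 ≤ C * E + ν * K * Real.sqrt E := by
    refine le_of_forall_pos_lt_add fun η hη => ?_
    by_cases hKE : K * Real.sqrt E = 0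
    · have := key 1 one_pos
      rw [mul_assoc, hKE, mul_zero, add_zero] at this
      rw [mul_assoc, hKE, mul_zero, add_zero]
      linarith
    · have hKEpos : 0 < K * Real.sqrt E :=
        lt_of_le_of_ne (mul_nonneg hK0 (Real.sqrt_nonneg E)) (Ne.symm hKE)
      have hK1 : K ≠ 0 := (mul_ne_zero_iff.1 hKE).1
      have hE1 : Real.sqrt E ≠ 0 := (mul_ne_zero_iff.1 hKE).2
      have := key (η / (2 * (K * Real.sqrt E))) (by positivity)
      calc fnorm S c ^ 2 ≤ C * E + (ν + η / (2 * (K * Real.sqrt E))) * K * Real.sqrt E := this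
        _ = C * E + ν * K * Real.sqrt E + η / 2 := by field_simp; ring
        _ < C * E + ν * K * Real.sqrt E + η := by linarith
  linarith

end Budget

/-! ## §4 Kill templates and why their available instances are vacuous -/

section Templates

variable {X : Type*} [TopologicalSpace X]

/-- **Meagre-confinement kill template.** In a Baire space, if near `c` the (relaxed) loud set is
contained in a countable union of closed nowhere-dense sets, then `c ∉ closure (interior LOUD)`.
This is the only cheap way to certify the kill shape without a census of periodic orbits: it needs
an EXACT (closed, positive-codimension) necessary condition for relaxed loudness valid on a whole
neighbourhood — e.g. an exact symmetry / resonance / linear constraint on `c'`. [folklore] -/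
theorem not_mem_closure_interior_of_subset_iUnion [BaireSpace X] {A V : Set X} {c : X}
    (F : ℕ → Set X) (hF : ∀ n, IsClosed (F n)) (hFi : ∀ n, interior (F n) = ∅) (hV : IsOpen V)
    (hc : c ∈ V) (hA : A ∩ V ⊆ ⋃ n, F n) : c ∉ closure (interior A) := by
  -- the complement of `⋃ F n` is a dense `G_δ`
  have hd : Dense (⋂ n, (F n)ᶜ) :=
    dense_iInter_of_isOpen_nat (fun n => (hF n).isOpen_compl) fun n => by
      rw [← interior_eq_empty_iff_dense_compl]; exact hFi n
  rw [not_mem_closure_interior_iff]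
  refine ⟨V, hV.mem_nhds hc, Set.disjoint_left.2 fun x hxV hxA => ?_⟩
  -- `interior A ∩ V` is an open set inside `⋃ F n`, hence empty
  have hopen : IsOpen (interior A ∩ V) := isOpen_interior.inter hV
  have hsub : interior A ∩ V ⊆ ⋃ n, F n := fun y hy => hA ⟨interior_subset hy.1, hy.2⟩
  obtain ⟨y, hyO, hyD⟩ := hd.inter_open_nonempty _ hopen ⟨x, hxA, hxV⟩
  have : y ∈ ⋃ n, F n := hsub hyO
  rw [Set.mem_iInter] at hyD
  obtain ⟨n, hn⟩ := Set.mem_iUnion.1 this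
  exact hyD n hn

/-- **Hyperplane-confinement instance**: if, near `c`, relaxed loudness forces a nonzero continuous
linear functional to vanish, the kill shape holds at `c` (a proper closed hyperplane is closed and
nowhere dense). For THIS crux the natural candidate — "the mean of the force must vanish, else
`d/dt ∫u = ∫f ≠ 0` excludes periodic orbits" — is vacuous: `hasZeroMean_force` shows the mean is
identically zero on `P_S`, so the functional is `0`. No other exact linear obstruction to
periodicity + loudness is known (VERDICT (K-lin)). [folklore] -/
theorem not_mem_closure_interior_of_subset_ker {V' : Type*} [NormedAddCommGroup V']
    [NormedSpace ℝ V'] {A V : Set V'} {c : V'} (ℓ : V' →L[ℝ] ℝ) (hℓ : ℓ ≠ 0) (hV : IsOpen V)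
    (hc : c ∈ V) (hA : ∀ x ∈ A ∩ V, ℓ x = 0) [BaireSpace V'] : c ∉ closure (interior A) := by
  set K : Set V' := ((LinearMap.ker (ℓ : V' →ₗ[ℝ] ℝ) : Submodule ℝ V') : Set V') with hK
  -- a proper closed hyperplane has empty interior
  have hint : interior K = ∅ := by
    by_contra hne
    have htop := (LinearMap.ker (ℓ : V' →ₗ[ℝ] ℝ)).eq_top_of_nonempty_interior'
      (Set.nonempty_iff_ne_empty.2 hne)
    apply hℓ
    ext v
    have hv : v ∈ LinearMap.ker (ℓ : V' →ₗ[ℝ] ℝ) := by rw [htop]; trivial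
    exact LinearMap.mem_ker.1 hv
  have hsub : A ∩ V ⊆ ⋃ _n : ℕ, K := fun x hx =>
    Set.mem_iUnion.2 ⟨0, show x ∈ K from LinearMap.mem_ker.2 (hA x hx)⟩
  exact not_mem_closure_interior_of_subset_iUnion (fun _ => K) (fun _ => ℓ.isClosed_ker)
    (fun _ => hint) hV hc hsub

end Templates


/-! ## §6 Non-vacuity and tightness: the laminar (Kolmogorov/shear) witness -/

section Laminar

open UnitAddTorus EuclideanSpace

/-- The gravest shear frequency `k₀ = (0,1,0)`. [folklore] -/
def k₀ : Fin 3 → ℤ := Pi.single 1 1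

/-- The polarisation `v₀ = (−i, 0, 0) ⊥ k₀` (so that `Re (e_{k₀} • v₀) = sin(2πx₂) e₁`). [folklore] -/
def v₀ : ℂ³ := WithLp.toLp 2 (Pi.single 0 (-Complex.I))

theorem k₀_apply (i : Fin 3) : k₀ i = if i = 1 then 1 else 0 := by
  simp [k₀, Pi.single_apply]

theorem v₀_apply (i : Fin 3) : v₀ i = if i = 0 then -Complex.I else 0 := by
  simp [v₀]

theorem k₀_ne_zero : k₀ ≠ 0 := by
  intro h; have := congrFun h 1; simp [k₀] at this

theorem neg_k₀_ne : -k₀ ≠ k₀ := by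
  intro h; have := congrFun h 1; simp [k₀] at this

theorem k₀_zero : k₀ 0 = 0 := by simp [k₀]

theorem freqNormSq_k₀ : freqNormSq k₀ = 1 := by
  simp [freqNormSq, k₀_apply]

/-- `k₀ · v₀ = 0`. [folklore] -/
theorem sum_k₀_mul_v₀ : ∑ j, (k₀ j : ℂ) * v₀ j = 0 := by
  simp [k₀_apply, v₀_apply]

theorem norm_v₀ : ‖v₀‖ = 1 := by
  rw [EuclideanSpace.norm_eq]
  simp [v₀_apply, Fin.sum_univ_three]

/-- The symmetric support `{k₀, −k₀}`. [folklore] -/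
def T₀ : Finset (Fin 3 → ℤ) := {k₀, -k₀}

theorem T₀_symm : ∀ k ∈ T₀, -k ∈ T₀ := by
  intro k hk
  simp only [T₀, Finset.mem_insert, Finset.mem_singleton] at hk ⊢
  rcases hk with rfl | rfl
  · exact Or.inr rfl
  · exact Or.inl (neg_neg _)

/-- Conjugate-symmetric coefficient family of the shear field of amplitude `r`:
`D r (±k₀) = (r/2) v₀`, resp. its conjugate. [folklore] -/
def D (r : ℝ) : (Fin 3 → ℤ) → ℂ³ := fun k =>
  if k = k₀ then ((r / 2 : ℝ) : ℂ) • v₀ else if k = -k₀ then ((r / 2 : ℝ) : ℂ) • conjVec v₀ else 0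

theorem D_k₀ (r : ℝ) : D r k₀ = ((r / 2 : ℝ) : ℂ) • v₀ := by simp [D]

theorem D_neg_k₀ (r : ℝ) : D r (-k₀) = ((r / 2 : ℝ) : ℂ) • conjVec v₀ := by
  simp [D, neg_k₀_ne]

theorem D_of_ne {r : ℝ} {k : Fin 3 → ℤ} (h1 : k ≠ k₀) (h2 : k ≠ -k₀) : D r k = 0 := by
  simp [D, h1, h2]

theorem isConjSymm_D (r : ℝ) : IsConjSymm (D r) := by
  intro k
  by_cases h1 : k = k₀
  · subst h1
    rw [D_neg_k₀, D_k₀, conjVec_smul, Complex.conj_ofReal]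
  by_cases h2 : k = -k₀
  · subst h2
    rw [neg_neg, D_k₀, D_neg_k₀, conjVec_smul, Complex.conj_ofReal, conjVec_conjVec]
  · have h1' : -k ≠ k₀ := fun h => h2 (by rw [← h, neg_neg])
    have h2' : -k ≠ -k₀ := fun h => h1 (neg_injective h)
    rw [D_of_ne h1' h2', D_of_ne h1 h2, conjVec_zero]

theorem isTransversal_D (r : ℝ) : IsTransversal T₀ (D r) := by
  intro k hk
  simp only [T₀, Finset.mem_insert, Finset.mem_singleton] at hk
  rcases hk with rfl | rfl
  · simp [D_k₀, k₀_apply, v₀_apply]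
  · simp [D_neg_k₀, k₀_apply, v₀_apply, conjVec_apply]

/-- The laminar shear field `sh r = r sin(2πx₂) e₁` as a real trigonometric polynomial. [folklore] -/
def sh (r : ℝ) : 𝕋³ → ℝ³ := realTrigPoly T₀ (D r)

theorem isSmooth_sh (r : ℝ) : IsSmooth (sh r) := isSmooth_realTrigPoly _ _

theorem isDivFree_sh (r : ℝ) : IsDivFree (sh r) := isDivFree_realTrigPoly (isTransversal_D r)

/-- `D r = r • D 1` coefficientwise. [folklore] -/
theorem D_eq_smul (r : ℝ) (k : Fin 3 → ℤ) : D r k = (r : ℂ) • D 1 k := by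
  by_cases h1 : k = k₀
  · subst h1; rw [D_k₀, D_k₀, smul_smul]; push_cast; ring_nf
  by_cases h2 : k = -k₀
  · subst h2; rw [D_neg_k₀, D_neg_k₀, smul_smul]; push_cast; ring_nf
  · rw [D_of_ne h1 h2, D_of_ne h1 h2, smul_zero]

/-- `sh r x = r • sh 1 x`. [folklore] -/
theorem sh_apply (r : ℝ) (x : 𝕋³) : sh r x = r • sh 1 x := by
  ext i
  simp only [sh, realTrigPoly_apply_coord, trigPoly_apply_coord, PiLp.smul_apply, smul_eq_mul]
  simp_rw [D_eq_smul r, PiLp.smul_apply, smul_eq_mul]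
  have hsum : (∑ k ∈ T₀, mFourier k x * ((r : ℂ) * D 1 k i)) = (r : ℂ) * ∑ k ∈ T₀, mFourier k x * D 1 k i := by
    rw [Finset.mul_sum]; exact Finset.sum_congr rfl fun k _ => by ring
  rw [hsum, Complex.re_ofReal_mul]

/-- The shear field is parallel to `e₁`: its other coordinates vanish. [folklore] -/
theorem sh_apply_of_ne (r : ℝ) (x : 𝕋³) {i : Fin 3} (hi : i ≠ 0) : sh r x i = 0 := by
  simp only [sh, realTrigPoly_apply_coord, trigPoly_apply_coord]
  rw [Finset.sum_eq_zero, Complex.zero_re]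
  intro k hk
  simp only [T₀, Finset.mem_insert, Finset.mem_singleton] at hk
  rcases hk with rfl | rfl
  · simp [D_k₀, v₀_apply, hi]
  · simp [D_neg_k₀, v₀_apply, hi, conjVec_apply]

/-- The shear field does not depend on `x₁`: `∂₁ sh = 0` (`k 0 = 0` on the support). [folklore] -/
theorem partialDeriv_zero_sh (r : ℝ) (x : 𝕋³) : partialDeriv 0 (sh r) x = 0 := by
  rw [sh, partialDeriv_realTrigPoly]
  have h : realTrigPoly T₀ (fun k => (2 * Real.pi * Complex.I * (k (0 : Fin 3) : ℂ)) • D r k) =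
      realTrigPoly T₀ 0 := by
    refine realTrigPoly_congr fun k hk => ?_
    simp only [T₀, Finset.mem_insert, Finset.mem_singleton] at hk
    rcases hk with rfl | rfl
    · simp [k₀_zero]
    · simp [k₀_zero]
  rw [h, realTrigPoly_zero]
  rfl

/-- **No self-advection**: `(sh·∇) sh = 0`. [folklore] -/
theorem convect_sh (r : ℝ) (x : 𝕋³) : Torus.convect (sh r) (sh r) x = 0 := by
  have hval : sh r x = (sh r x 0) • EuclideanSpace.single (0 : Fin 3) (1 : ℝ) := by
    ext i
    by_cases hi : i = 0
    · subst hi; simp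
    · rw [sh_apply_of_ne r x hi]; simp [hi]
  unfold Torus.convect
  rw [hval, map_smul, ← partialDeriv_eq_fderiv_apply ((isSmooth_sh r).isContDiff (by simp)),
    partialDeriv_zero_sh, smul_zero]

/-- The shear field is a Stokes eigenfield: `Δ sh = −4π² sh`. [folklore] -/
theorem laplacian_sh (r : ℝ) (x : 𝕋³) : laplacian (sh r) x = -(4 * Real.pi ^ 2) • sh r x := by
  rw [sh, laplacian_realTrigPoly]
  have h : realTrigPoly T₀ (fun k => -(((4 * Real.pi ^ 2 * freqNormSq k : ℝ) : ℂ) • D r k)) =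
      realTrigPoly T₀ (D (-(4 * Real.pi ^ 2) * r)) := by
    refine realTrigPoly_congr fun k hk => ?_
    have hk1 : freqNormSq k = 1 := by
      simp only [T₀, Finset.mem_insert, Finset.mem_singleton] at hk
      rcases hk with rfl | rfl
      · exact freqNormSq_k₀
      · rw [freqNormSq_neg]; exact freqNormSq_k₀
    rw [hk1, mul_one, D_eq_smul (-(4 * Real.pi ^ 2) * r), D_eq_smul r, smul_smul, ← neg_smul]
    push_cast; ring_nf
  rw [h]
  change sh (-(4 * Real.pi ^ 2) * r) x = -(4 * Real.pi ^ 2) • sh r x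
  rw [sh_apply, sh_apply r, smul_smul]

/-- `‖sh r‖₂² = r²/2`. [folklore] -/
theorem integral_norm_sq_sh (r : ℝ) : ∫ x, ‖sh r x‖ ^ 2 = r ^ 2 / 2 := by
  rw [sh, integral_norm_sq_realTrigPoly T₀_symm (isConjSymm_D r)]
  have hT : T₀ = insert k₀ {-k₀} := rfl
  rw [hT, Finset.sum_insert (by simp [neg_k₀_ne.symm] : k₀ ∉ ({-k₀} : Finset (Fin 3 → ℤ))),
    Finset.sum_singleton, D_k₀, D_neg_k₀, norm_smul, norm_smul, norm_conjVec, norm_v₀,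
    Complex.norm_real, Real.norm_eq_abs]
  rw [mul_one, ← sq_abs r]
  have : |r / 2| = |r| / 2 := by rw [abs_div, abs_two]
  rw [this]; ring

/-- `‖∇ sh r‖₂² = 2π² r²` (spectral). [folklore] -/
theorem eGradNormSq_sh (r : ℝ) : eGradNormSq (sh r) = ENNReal.ofReal (2 * Real.pi ^ 2 * r ^ 2) := by
  rw [sh, eGradNormSq_realTrigPoly T₀_symm (isConjSymm_D r)]
  congr 1
  have hT : T₀ = insert k₀ {-k₀} := rfl
  rw [hT, Finset.sum_insert (by simp [neg_k₀_ne.symm] : k₀ ∉ ({-k₀} : Finset (Fin 3 → ℤ))),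
    Finset.sum_singleton, D_k₀, D_neg_k₀, norm_smul, norm_smul, norm_conjVec, norm_v₀,
    Complex.norm_real, Real.norm_eq_abs, freqNormSq_neg, freqNormSq_k₀]
  rw [mul_one, ← sq_abs r]
  have : |r / 2| = |r| / 2 := by rw [abs_div, abs_two]
  rw [this]; ring

variable {S : Finset (Fin 3 → ℤ)}

/-- The laminar coefficient vector of amplitude `A` in any `P_S` with `k₀ ∈ S`: `A v₀` at `k₀`,
zero elsewhere (so `f_{cLam A} = A sin(2πx₂) e₁ = sh A`). [folklore] -/
def cLam (S : Finset (Fin 3 → ℤ)) (A : ℝ) : Coeff S := fun k => if (k : Fin 3 → ℤ) = k₀ then (A : ℂ) • v₀ else 0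

theorem forceCoeff_cLam (hS : k₀ ∈ S) (A : ℝ) (k : Fin 3 → ℤ) :
    forceCoeff S (cLam S A) k = if k = k₀ then (A : ℂ) • v₀ else 0 := by
  by_cases hk : k = k₀
  · subst hk
    rw [if_pos rfl, forceCoeff, coeffExt_of_mem _ hS]
    have : cLam S A ⟨k₀, hS⟩ = (A : ℂ) • v₀ := by simp [cLam]
    rw [this, lerayCoeff_smul, Torus.lerayCoeff_of_ne_zero k₀_ne_zero,
      Torus.leraySym_of_transversal sum_k₀_mul_v₀]
  · rw [if_neg hk, forceCoeff]
    have hz : coeffExt S (cLam S A) k = 0 := by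
      by_cases hkS : k ∈ S
      · rw [coeffExt_of_mem _ hkS]; simp [cLam, hk]
      · exact coeffExt_of_not_mem _ hkS
    simp only [hz]
    by_cases h0 : k = 0
    · subst h0; simp
    · rw [Torus.lerayCoeff_of_ne_zero h0, Torus.leraySym_zero]

/-- **`f_{cLam A} = sh A`**: the designer force of the laminar coefficient vector is the shear force. [folklore] -/
theorem force_cLam (hS : k₀ ∈ S) (A : ℝ) : force S (cLam S A) = sh A := by
  funext x
  -- both sides are `Re (e_{k₀}(x) • A v₀)`
  have hL : force S (cLam S A) x = realPart (mFourier k₀ x • ((A : ℂ) • v₀)) := by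
    rw [force_eq, realTrigPoly_apply]
    congr 1
    rw [trigPoly_apply, Finset.sum_eq_single_of_mem k₀ hS fun k _ hk => by
      rw [forceCoeff_cLam hS, if_neg hk, smul_zero]]
    rw [forceCoeff_cLam hS, if_pos rfl]
  have hR : sh A x = realPart (mFourier k₀ x • ((A : ℂ) • v₀)) := by
    rw [sh, realTrigPoly_apply, trigPoly_apply]
    have hT : T₀ = insert k₀ {-k₀} := rfl
    rw [hT, Finset.sum_insert (by simp [neg_k₀_ne.symm] : k₀ ∉ ({-k₀} : Finset (Fin 3 → ℤ))),
      Finset.sum_singleton, D_k₀, D_neg_k₀, map_add]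
    have hconj : mFourier (-k₀) x • (((A / 2 : ℝ) : ℂ) • conjVec v₀) =
        conjVec (mFourier k₀ x • (((A / 2 : ℝ) : ℂ) • v₀)) := by
      rw [conjVec_smul, conjVec_smul, Complex.conj_ofReal, mFourier_neg]
    rw [hconj, realPart_conjVec, ← two_smul ℝ, ← map_smul]
    congr 1
    ext i
    simp only [PiLp.smul_apply, smul_eq_mul, Complex.real_smul]
    push_cast; ring
  rw [hL, hR]

/-- **The laminar steady state is a classical solution** of NS_ν forced by `f_{cLam A}`:
`u = (4π²ν)⁻¹ f`, `p = 0` (exact for every `ν ≠ 0` and every amplitude). [folklore] -/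
theorem lam_isClassical (hS : k₀ ∈ S) {ν : ℝ} (hν : ν ≠ 0) (A : ℝ) :
    IsClassicalNSSolutionOn Set.univ ν (fun _ => force S (cLam S A))
      (fun _ => sh (A / (4 * Real.pi ^ 2 * ν))) (fun _ _ => 0) where
  smooth_velocity := isSmoothSpaceTimeOn_const (isSmooth_sh _) _
  smooth_pressure := isSmoothSpaceTimeOn_const (isSmooth_const _) _
  momentum := fun t _ x => by
    have h0 : Torus.timeDerivWithin Set.univ (fun _ : ℝ => sh (A / (4 * Real.pi ^ 2 * ν))) t x = 0 := by
      simp [Torus.timeDerivWithin]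
    have hg : Torus.gradient (fun _ : 𝕋³ => (0 : ℝ)) x = 0 := by
      have : liftAt (fun _ : 𝕋³ => (0 : ℝ)) x = fun _ => 0 := rfl
      rw [Torus.gradient, this]
      exact gradient_fun_const 0 0
    rw [h0, convect_sh, laplacian_sh, hg, sub_zero, zero_add, force_cLam hS, sh_apply A,
      sh_apply (A / (4 * Real.pi ^ 2 * ν)), smul_smul, smul_smul, ← add_smul]
    have : ν * -(4 * Real.pi ^ 2) * (A / (4 * Real.pi ^ 2 * ν)) + A = 0 := by
      field_simp; ring
    rw [this, zero_smul]
  divFree := fun _ _ => isDivFree_sh _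

/-- Mean energy of the steady laminar state: `⟨‖u‖₂²⟩ = r²/2`. [folklore] -/
theorem meanEnergy_sh (r : ℝ) : meanEnergy (fun _ : ℝ => sh r) = r ^ 2 / 2 := by
  rw [meanEnergy_eq_of_periodic (τ := 1) (fun _ => rfl) one_pos]
  simp [integral_norm_sq_sh]

/-- Mean dissipation of the steady laminar state: `ν⟨‖∇u‖₂²⟩ = 2π²ν r²`. [folklore] -/
theorem meanDissipation_sh (ν r : ℝ) :
    meanDissipation ν (fun _ : ℝ => sh r) = ν * (2 * Real.pi ^ 2 * r ^ 2) := by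
  rw [meanDissipation_eq_of_periodic (τ := 1) (fun _ => rfl) one_pos]
  simp [eGradNormSq_sh, ENNReal.toReal_ofReal (by positivity : (0 : ℝ) ≤ 2 * Real.pi ^ 2 * r ^ 2)]

/-- Laminar budgets at amplitude `A` and viscosity `ν`: `E_lam = A²/(32π⁴ν²)`, `ε_lam = A²/(8π²ν)`. -/
def Elam (A ν : ℝ) : ℝ := (A / (4 * Real.pi ^ 2 * ν)) ^ 2 / 2

/-- see `Elam`. -/
def εlam (A ν : ℝ) : ℝ := ν * (2 * Real.pi ^ 2 * (A / (4 * Real.pi ^ 2 * ν)) ^ 2)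

theorem εlam_pos {A ν : ℝ} (hA : A ≠ 0) (hν : 0 < ν) : 0 < εlam A ν := by
  unfold εlam
  have : A / (4 * Real.pi ^ 2 * ν) ≠ 0 := by positivity
  positivity

/-- **NON-VACUITY: `cLam A ∈ LOUD^{(0,a)}(S, E_lam, ε_lam)`** for every `S ∋ k₀`, every amplitude
`A ≠ 0`, every ceiling `a > 0` and every `ν ∈ (0,a)` — at EVERY level the loud set is non-empty
(with level-dependent budgets; with FIXED budgets laminar witnesses die at high levels, by the
power bound: `ε_lam = ‖f‖₂ √E_lam` saturates it and `E_lam ∝ ν⁻²`). [folklore] -/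
theorem cLam_mem_loud (hS : k₀ ∈ S) {A a ν : ℝ} (hν : 0 < ν) (hνa : ν < a) :
    cLam S A ∈ loud S a (Elam A ν) (εlam A ν) :=
  ⟨ν, hν, hνa, 1, _, _, one_pos, lam_isClassical hS hν.ne' A, fun _ => rfl,
    (meanEnergy_sh _).le, (meanDissipation_sh ν _).ge⟩

/-- `LOUD` is non-empty at every level (for suitable budgets). [folklore] -/
theorem loud_nonempty (hS : k₀ ∈ S) {a : ℝ} (ha : 0 < a) :
    ∃ E ε : ℝ, 0 < ε ∧ (loud S a E ε).Nonempty :=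
  ⟨Elam 1 (a / 2), εlam 1 (a / 2), εlam_pos one_ne_zero (by positivity),
    cLam S 1, cLam_mem_loud hS (by positivity) (by linarith)⟩

/-- `‖f_{cLam A}‖₂ = |A|/√2`. [folklore] -/
theorem fnorm_cLam (hS : k₀ ∈ S) (A : ℝ) : fnorm S (cLam S A) = |A| / Real.sqrt 2 := by
  rw [fnorm, force_cLam hS, integral_norm_sq_sh, Real.sqrt_div' _ zero_le_two, Real.sqrt_sq_eq_abs]

/-- **TIGHTNESS of the power bound**: the laminar witness saturates `ε ≤ ‖f_c‖₂ √E`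
(`u ∥ f`, steady). [folklore] -/
theorem power_bound_tight (hS : k₀ ∈ S) {A ν : ℝ} (hA : 0 < A) (hν : 0 < ν) :
    εlam A ν = fnorm S (cLam S A) * Real.sqrt (Elam A ν) := by
  rw [fnorm_cLam hS, Elam, εlam, abs_of_pos hA, Real.sqrt_div' _ zero_le_two,
    Real.sqrt_sq (by positivity : 0 ≤ A / (4 * Real.pi ^ 2 * ν))]
  have h2 : Real.sqrt 2 ≠ 0 := by positivity
  field_simp
  rw [Real.sq_sqrt zero_le_two]
  ring

/-- `cLam` is linear in the amplitude. [folklore] -/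
theorem cLam_smul (θ A : ℝ) : cLam S (θ * A) = θ • cLam S A := by
  funext k
  simp only [cLam, Pi.smul_apply]
  split_ifs
  · rw [Complex.ofReal_mul, mul_smul, Complex.coe_smul]
  · rw [smul_zero]

/-- **SHARP-BUDGET NON-OPENNESS (generation 1, re-proved): the laminar ray leaves `LOUD` below
`θ = 1`.** With the sharp budgets `(E_lam, ε_lam)` of `cLam A` at `ν`, every `θ • cLam A` with
`0 ≤ θ < 1` is QUIET at EVERY viscosity and every level (power bound: its power ceiling is
`θ ε_lam < ε_lam`). Hence `cLam A ∈ LOUD ∖ interior LOUD`: `LOUD(S,E,ε)` is not open, and the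
strengthening of the crux with `interior` in place of `closure ∘ interior` and SHARP budgets is
false in every `P_S` with `k₀ ∈ S`. [folklore] -/
theorem smul_cLam_not_mem_loud (hS : k₀ ∈ S) {A ν θ a : ℝ} (hA : 0 < A) (hν : 0 < ν)
    (hθ0 : 0 ≤ θ) (hθ : θ < 1) : θ • cLam S A ∉ loud S a (Elam A ν) (εlam A ν) := by
  refine not_mem_loud_of_power_lt ?_
  rw [← cLam_smul, fnorm_cLam hS, abs_of_nonneg (mul_nonneg hθ0 hA.le)]
  have htight := power_bound_tight hS hA hν
  rw [fnorm_cLam hS, abs_of_pos hA] at htight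
  have hε : 0 < εlam A ν := εlam_pos hA.ne' hν
  calc θ * A / Real.sqrt 2 * Real.sqrt (Elam A ν) = θ * (A / Real.sqrt 2 * Real.sqrt (Elam A ν)) := by ring
    _ = θ * εlam A ν := by rw [← htight]
    _ < 1 * εlam A ν := mul_lt_mul_of_pos_right hθ hε
    _ = εlam A ν := one_mul _

/-- `cLam A` is NOT an interior point of the sharp loud set (the quiet ray accumulates at it). [folklore] -/
theorem cLam_not_mem_interior_loud (hS : k₀ ∈ S) {A ν a : ℝ} (hA : 0 < A) (hν : 0 < ν) :
    cLam S A ∉ interior (loud S a (Elam A ν) (εlam A ν)) := by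
  intro h
  rw [mem_interior_iff_mem_nhds] at h
  -- the ray `θ ↦ θ • cLam A` is continuous at `θ = 1`
  have hcont : Tendsto (fun θ : ℝ => θ • cLam S A) (𝓝[<] 1) (𝓝 (cLam S A)) := by
    have : Tendsto (fun θ : ℝ => θ • cLam S A) (𝓝 1) (𝓝 ((1 : ℝ) • cLam S A)) :=
      (continuous_id.smul continuous_const).tendsto 1
    rw [one_smul] at this
    exact this.mono_left nhdsWithin_le_nhds
  have hev := hcont.eventually h
  have hpos : ∀ᶠ θ in 𝓝[<] (1 : ℝ), 0 ≤ θ ∧ θ < 1 := by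
    have h1 : ∀ᶠ θ in 𝓝[<] (1 : ℝ), θ < 1 := eventually_nhdsWithin_of_forall fun θ hθ => hθ
    have h2 : ∀ᶠ θ in 𝓝[<] (1 : ℝ), 0 ≤ θ :=
      (eventually_ge_nhds (by norm_num : (0 : ℝ) < 1)).filter_mono nhdsWithin_le_nhds
    exact h2.and h1
  obtain ⟨θ, hθmem, hθ0, hθ1⟩ := (hev.and hpos).exists
  exact smul_cLam_not_mem_loud hS hA hν hθ0 hθ1 hθmem

/-- **The strengthening "LOUD is open" (sharp budgets, `interior` instead of `closure ∘ interior`)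
is FALSE** for every `S ∋ k₀`, every ceiling and the laminar budgets. [folklore] -/
theorem not_isOpen_loud (hS : k₀ ∈ S) {A ν a : ℝ} (hA : 0 < A) (hν : 0 < ν) (hνa : ν < a) :
    ¬ IsOpen (loud S a (Elam A ν) (εlam A ν)) := fun hopen =>
  cLam_not_mem_interior_loud hS hA hν (a := a)
    (by rw [hopen.interior_eq]; exact cLam_mem_loud hS hν hνa)

end Laminar


/-! ## §7 Bookkeeping: stocks, zero-extension, relaxation constants -/

section Bookkeeping

/-- The crux with a GIVEN stock `S₀`. [folklore] -/
def UpgradeWith (S₀ : Finset (Fin 3 → ℤ)) : Prop :=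
  ∀ S : Finset (Fin 3 → ℤ), S₀ ⊆ S → ∀ (E ε : ℝ), 0 < ε →
    ∀ j : ℕ, loud S (ceil j) E ε ⊆ closure (interior (loud S (ceil j) (2 * E) (ε / 2)))

theorem crux_iff_exists_upgradeWith : RobustLoudUpgrade ↔ ∃ S₀, UpgradeWith S₀ := Iff.rfl

/-- **Stocks are monotone**: enlarging the stock weakens the obligation, so WLOG `S₀` is as rich
as any prover likes (rank 3, symmetric, containing `k₀`, …) — and a refuter must beat EVERY finite
stock. [folklore] -/
theorem upgradeWith_mono {S₀ S₁ : Finset (Fin 3 → ℤ)} (h : S₀ ⊆ S₁) (h₀ : UpgradeWith S₀) :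
    UpgradeWith S₁ := fun S hS => h₀ S (h.trans hS)

variable {S S' : Finset (Fin 3 → ℤ)}

/-- Zero-extension of coefficient vectors along `S ⊆ S'`. [folklore] -/
def extend (_h : S ⊆ S') (c : Coeff S) : Coeff S' := fun k => coeffExt S c k

theorem coeffExt_extend (h : S ⊆ S') (c : Coeff S) : coeffExt S' (extend h c) = coeffExt S c := by
  funext k
  by_cases hk' : k ∈ S'
  · rw [coeffExt_of_mem _ hk']; rfl
  · rw [coeffExt_of_not_mem _ hk', coeffExt_of_not_mem _ fun hk => hk' (h hk)]

/-- **The force only sees the coefficients**: `f_{extend c} = f_c`. [folklore] -/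
theorem force_extend (h : S ⊆ S') (c : Coeff S) : force S' (extend h c) = force S c := by
  have hc : forceCoeff S' (extend h c) = forceCoeff S c := by
    funext k; simp only [forceCoeff, coeffExt_extend]
  rw [force_eq, force_eq, hc, realTrigPoly_eq_comp, realTrigPoly_eq_comp,
    trigPoly_subset h fun k _ hk => ?_]
  simp only [forceCoeff, coeffExt_of_not_mem _ hk]
  by_cases h0 : k = 0
  · subst h0; simp
  · rw [Torus.lerayCoeff_of_ne_zero h0, Torus.leraySym_zero]

/-- **`LOUD` is compatible with zero-extension**: `c ∈ LOUD_S ↔ extend c ∈ LOUD_{S'}`. CAVEAT for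
provers: `interior` is NOT — the interior of `LOUD_{S'}` in the bigger `P_{S'}` can have a SMALLER
trace on `P_S` than `interior LOUD_S` (a subset of a hyperplane has empty interior), so
"prove the upgrade in `P_{S₀}` and extend" is not a valid strategy; the extra directions of
`P_S ⊖ P_{S₀}` must be controlled (this is exactly where the stock is load-bearing). [folklore] -/
theorem mem_loud_iff_extend (h : S ⊆ S') (c : Coeff S) {a E ε : ℝ} :
    c ∈ loud S a E ε ↔ extend h c ∈ loud S' a E ε := by
  simp only [loud, Set.mem_setOf_eq, force_extend]

/-- Larger relaxation constants give WEAKER cruxes: `(2E, ε/2) ⊆ (κE, ε/κ')` for `κ, κ' ≥ 2`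
(`E ≥ 0` automatic). So only SHARPER constants could be refuted; the sharp case `κ = κ' = 1`
("closure ∘ interior with sharp budgets") is open — at the laminar point it plausibly HOLDS
(generation 1: `c_lam ∈ closure(LOUD ∖ {c_lam})` along `θ > 1`). [folklore] -/
theorem loud_relaxed_mono {a E ε κ κ' : ℝ} (hκ : 2 ≤ κ) (hκ' : 2 ≤ κ') (hε : 0 ≤ ε) :
    loud S a (2 * E) (ε / 2) ⊆ loud S a (κ * E) (ε / κ') := by
  intro c hc
  have hE : 0 ≤ 2 * E := energy_nonneg_of_mem_loud hc
  refine loud_mono le_rfl ?_ ?_ hc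
  · nlinarith
  · exact div_le_div_of_nonneg_left hε (by norm_num) hκ'

end Bookkeeping

/-! ## §8 Load-bearing hypothesis `0 < ε` (generation 1, re-proved): without it the crux is FALSE -/

section PosBudget

variable {S : Finset (Fin 3 → ℤ)} {a : ℝ}

/-- The crux with the hypothesis `0 < ε` DROPPED. [folklore] -/
def CruxWithoutPosBudget : Prop :=
  ∃ S₀ : Finset (Fin 3 → ℤ), ∀ S : Finset (Fin 3 → ℤ), S₀ ⊆ S → ∀ (E ε : ℝ),
    ∀ j : ℕ, loud S (ceil j) E ε ⊆ closure (interior (loud S (ceil j) (2 * E) (ε / 2)))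

/-- A time-periodic classical solution with mean energy `≤ 0` vanishes identically. [folklore] -/
theorem velocity_eq_zero_of_meanEnergy_nonpos {ν τ : ℝ} {f u : ℝ → 𝕋³ → ℝ³} {p : ℝ → 𝕋³ → ℝ}
    (hsol : IsClassicalNSSolutionOn Set.univ ν f u p) (hτ : 0 < τ) (hper : Function.Periodic u τ)
    (hE : meanEnergy u ≤ 0) (t : ℝ) : u t = 0 := by
  -- `g t = ∫ ‖u t‖²` is continuous, nonnegative, `τ`-periodic with period average `≤ 0`
  set g : ℝ → ℝ := fun t => ∫ x, ‖u t x‖ ^ 2 with hg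
  have hsm : Torus.IsSmoothSpaceTimeOn Set.univ (fun t x => ‖u t x‖ ^ 2) := by
    have := hsol.smooth_velocity
    unfold Torus.IsSmoothSpaceTimeOn at this ⊢
    exact this.norm_sq (𝕜 := ℝ)
  have hcont : Continuous g := by
    rw [← continuousOn_univ]
    exact hsm.continuousOn_integral convex_univ
  have hg0 : ∀ s, 0 ≤ g s := fun s => integral_nonneg fun _ => sq_nonneg _
  have hgper : Function.Periodic g τ := fun s => by simp only [hg, hper s]
  have havg : τ⁻¹ * ∫ s in (0 : ℝ)..τ, g s ≤ 0 := by
    rw [← meanEnergy_eq_of_periodic hper hτ]; exact hE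
  have hint : ∫ s in (0 : ℝ)..τ, g s ≤ 0 := by
    have := mul_nonpos_iff.1 havg
    rcases this with ⟨_, h2⟩ | ⟨h1, _⟩
    · exact h2
    · exact absurd h1 (not_le.2 (inv_pos.2 hτ))
  have hint0 : ∫ s in (0 : ℝ)..τ, g s = 0 :=
    le_antisymm hint (intervalIntegral.integral_nonneg hτ.le fun s _ => hg0 s)
  -- hence `g = 0` on `[0, τ]`, hence everywhere by periodicity
  have hzero : ∀ s ∈ Set.Icc (0 : ℝ) τ, g s = 0 := by
    by_contra hne
    push Not at hne
    obtain ⟨s, hs, hgs⟩ := hne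
    have hpos : 0 < g s := lt_of_le_of_ne (hg0 s) (Ne.symm hgs)
    have hlt := intervalIntegral.integral_lt_integral_of_continuousOn_of_le_of_exists_lt hτ
      continuousOn_const hcont.continuousOn (fun x _ => hg0 x) ⟨s, hs, hpos⟩
    rw [intervalIntegral.integral_zero, hint0] at hlt
    exact lt_irrefl _ hlt
  obtain ⟨y, hy, hty⟩ := hgper.exists_mem_Ico₀ hτ t
  have hgt : g t = 0 := by rw [hty]; exact hzero y (Set.Ico_subset_Icc_self hy)
  exact Torus.eq_zero_of_integral_norm_sq_nonpos (hsol.smooth_velocity.isSmooth_slice (Set.mem_univ t))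
    hgt.le

variable {c : Coeff S}

/-- **`LOUD(S,0,0) ⊆ ker (c ↦ f_c)`**: a loud witness with energy budget `0` is the zero flow, and
then the momentum equation reads `f_c = ∇p`, so the divergence-free mean-zero `f_c` vanishes
(`∫‖f_c‖² = ∫⟪f_c,∇p⟫ = −∫ p div f_c = 0`). [folklore] -/
theorem force_eq_zero_of_mem_loud_zero (hc : c ∈ loud S a 0 0) : force S c = 0 := by
  obtain ⟨ν, -, -, τ, u, p, hτ, hsol, hper, hE, -⟩ := hc
  have hu : ∀ t, u t = 0 := velocity_eq_zero_of_meanEnergy_nonpos hsol hτ hper hE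
  have hu' : u = fun _ _ => 0 := by
    funext t y; rw [hu t]; rfl
  subst hu'
  -- momentum at time `0`: `f_c = ∇ (p 0)`
  have hgrad : ∀ x, Torus.gradient (p 0) x = force S c x := fun x => by
    have hm := hsol.momentum 0 (Set.mem_univ _) x
    have h0 : Torus.timeDerivWithin Set.univ (fun (_ : ℝ) (_ : 𝕋³) => (0 : ℝ³)) 0 x = 0 := by
      simp [Torus.timeDerivWithin]
    rw [h0, convect_fun_const, laplacian_fun_const, smul_zero, zero_sub, zero_add, eq_comm,
      neg_add_eq_zero] at hm
    exact hm
  have hp : IsSmooth (p 0) := hsol.smooth_pressure.isSmooth_slice (Set.mem_univ _)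
  have hibp := integral_inner_gradient_eq_neg_integral_mul_divergence_holds (isSmooth_force c) hp
  have hdiv : ∀ x, divergence (force S c) x = 0 := isDivFree_force c
  simp_rw [hdiv, mul_zero, integral_zero, neg_zero] at hibp
  have hsq : ∫ x, ‖force S c x‖ ^ 2 = 0 := by
    have : ∀ x, ‖force S c x‖ ^ 2 = ⟪force S c x, Torus.gradient (p 0) x⟫_ℝ := fun x => by
      rw [hgrad x, real_inner_self_eq_norm_sq]
    simp_rw [this]
    exact hibp
  exact Torus.eq_zero_of_integral_norm_sq_nonpos (isSmooth_force c) hsq.le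

theorem cLam_zero : cLam S 0 = 0 := by
  funext k; simp [cLam]

/-- `0 ∈ LOUD(S,0,0)` (the zero flow under the zero force; here obtained as the laminar witness of
amplitude `0`). [folklore] -/
theorem zero_mem_loud_zero_zero (hS : k₀ ∈ S) (ha : 0 < a) : (0 : Coeff S) ∈ loud S a 0 0 := by
  have h := cLam_mem_loud (S := S) hS (A := 0) (a := a) (ν := a / 2) (by positivity) (by linarith)
  rwa [cLam_zero, show Elam 0 (a / 2) = 0 by simp [Elam], show εlam 0 (a / 2) = 0 by simp [εlam]] at h

/-- The kernel of the force map is a proper subspace as soon as `k₀ ∈ S`. [folklore] -/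
theorem ker_forceₗ_ne_top (hS : k₀ ∈ S) : LinearMap.ker (forceₗ S) ≠ ⊤ := by
  intro htop
  have hmem : cLam S 1 ∈ LinearMap.ker (forceₗ S) := by rw [htop]; trivial
  have h0 : force S (cLam S 1) = 0 := LinearMap.mem_ker.1 hmem
  have h1 : ∫ x, ‖force S (cLam S 1) x‖ ^ 2 = (1 : ℝ) ^ 2 / 2 := by
    rw [force_cLam hS, integral_norm_sq_sh]
  rw [h0] at h1
  norm_num at h1

/-- **Dropping `0 < ε` makes the crux FALSE** (for EVERY stock): at `E = ε = 0` the loud set of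
`S = insert k₀ S₀` is squeezed into the proper closed subspace `ker (c ↦ f_c)` yet contains `0`, so
`0 ∈ LOUD ∖ closure (interior LOUD)`. Any proof of the crux must use `ε > 0`. [folklore] -/
theorem crux_false_without_pos_budget : ¬ CruxWithoutPosBudget := by
  rintro ⟨S₀, h⟩
  have hS : k₀ ∈ insert k₀ S₀ := Finset.mem_insert_self _ _
  have hsub := h (insert k₀ S₀) (Finset.subset_insert _ _) 0 0 0
  rw [mul_zero, zero_div] at hsub
  have h0 : (0 : Coeff (insert k₀ S₀)) ∈ loud (insert k₀ S₀) (ceil 0) 0 0 :=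
    zero_mem_loud_zero_zero hS (by norm_num [ceil])
  have hcl := hsub h0
  set K := LinearMap.ker (forceₗ (insert k₀ S₀)) with hK
  have hclosed : IsClosed (K : Set (Coeff (insert k₀ S₀))) := K.closed_of_finiteDimensional
  have hint : interior (K : Set (Coeff (insert k₀ S₀))) = ∅ := by
    by_contra hne
    exact ker_forceₗ_ne_top hS (K.eq_top_of_nonempty_interior' (Set.nonempty_iff_ne_empty.2 hne))
  refine not_mem_closure_interior_of_subset_iUnion (fun _ => (K : Set (Coeff (insert k₀ S₀))))
    (fun _ => hclosed) (fun _ => hint) isOpen_univ (Set.mem_univ _) (fun c hc => ?_) hcl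
  exact Set.mem_iUnion.2 ⟨0, LinearMap.mem_ker.2 (force_eq_zero_of_mem_loud_zero hc.1)⟩

end PosBudget


/-! ## §9 LEVEL IS DECORATION (generation 1, re-derived; scaling lemmas vendored from the sibling crux)

The parabolic rescaling `(u,p,ν,f) ↦ (αu(α·), α²p(α·), αν, α²f)` maps `LOUD^{(0,a)}(S,E,ε)` onto
`LOUD^{(0,αa)}(S,α²E,α³ε)` along the homothety `c ↦ α²c` of `P_S`, which commutes with `closure` and
`interior`.  Hence the crux is EQUIVALENT to its level-`0` instance (`crux_iff_levelZero`): provers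
may fix the ceiling `ν < 1`.  The lemmas `timeRescale … loudAt_iff_timeRescale` are VENDORED verbatim
(namespace apart) from `Cruxes/DenseLoudDesignerForces/Disproof.lean` §10 (cdisprove seat of
stmt-1143, 2026-08-15) to keep this file independent of a moving work file. -/

section Level

variable {ν lam τ : ℝ} {F : 𝕋³ → ℝ³} {u : ℝ → 𝕋³ → ℝ³} {p : ℝ → 𝕋³ → ℝ}

/-- PARABOLIC TIME RESCALING of a global classical solution with steady force:
`(u,p) ↦ (λu(λ·), λ²p(λ·))` solves NS with viscosity `λν` and force `λ²F` (vendored, see above). [folklore] -/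
theorem timeRescale (h : IsClassicalNSSolutionOn univ ν (fun _ => F) u p) (lam : ℝ) :
    IsClassicalNSSolutionOn univ (lam * ν) (fun _ => lam ^ 2 • F) (fun t x => lam • u (lam * t) x)
      (fun t x => lam ^ 2 * p (lam * t) x) where
  smooth_velocity := by
    have hφ : ContDiff ℝ ((⊤ : ℕ∞) : WithTop ℕ∞)
        (fun z : ℝ × EuclideanSpace ℝ (Fin 3) => ((lam * z.1, z.2) : ℝ × EuclideanSpace ℝ (Fin 3))) :=
      (contDiff_const.mul contDiff_fst).prodMk contDiff_snd
    have h1 : Torus.IsSmoothSpaceTimeOn univ (fun t x => u (lam * t) x) :=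
      h.smooth_velocity.comp hφ.contDiffOn (fun z _ => mk_mem_prod (mem_univ _) (mem_univ _))
    exact h1.const_smul lam
  smooth_pressure := by
    have hφ : ContDiff ℝ ((⊤ : ℕ∞) : WithTop ℕ∞)
        (fun z : ℝ × EuclideanSpace ℝ (Fin 3) => ((lam * z.1, z.2) : ℝ × EuclideanSpace ℝ (Fin 3))) :=
      (contDiff_const.mul contDiff_fst).prodMk contDiff_snd
    have h1 : Torus.IsSmoothSpaceTimeOn univ (fun t x => p (lam * t) x) :=
      h.smooth_pressure.comp hφ.contDiffOn (fun z _ => mk_mem_prod (mem_univ _) (mem_univ _))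
    have := h1.const_smul (lam ^ 2)
    simpa only [smul_eq_mul] using this
  momentum t _ x := by
    have hus : IsSmooth (u (lam * t)) := h.smooth_velocity.isSmooth_slice (mem_univ _)
    have hps : IsSmooth (p (lam * t)) := h.smooth_pressure.isSmooth_slice (mem_univ _)
    have h1 : Torus.timeDerivWithin univ (fun t x => lam • u (lam * t) x) t x =
        lam • (lam • Torus.timeDerivWithin univ u (lam * t) x) := by
      have hg : HasDerivWithinAt (fun s => u s x) (Torus.timeDerivWithin univ u (lam * t) x) univ (lam * t) :=
        h.smooth_velocity.hasDerivWithinAt_slice (mem_univ _) x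
      have hh : HasDerivWithinAt (fun s : ℝ => lam * s) lam univ t := by
        simpa using (hasDerivWithinAt_id t univ).const_mul lam
      have hcomp := (hg.scomp t hh (mapsTo_univ _ _)).const_smul lam
      exact hcomp.derivWithin (uniqueDiffOn_univ t (mem_univ t))
    have h2 : Torus.convect (fun x => lam • u (lam * t) x) (fun x => lam • u (lam * t) x) x =
        lam • (lam • Torus.convect (u (lam * t)) (u (lam * t)) x) := by
      change Torus.fderiv (lam • u (lam * t)) x (lam • u (lam * t) x) = _
      rw [Torus.fderiv_const_smul (hus.isContDiff (by simp)), FunLike.coe_smul, Pi.smul_apply,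
        map_smul]
      rfl
    have h3 : Torus.gradient (fun x => lam ^ 2 * p (lam * t) x) x = lam ^ 2 • Torus.gradient (p (lam * t)) x := by
      change Torus.gradient (lam ^ 2 • p (lam * t)) x = _
      exact Torus.gradient_const_smul (hps.isContDiff (by simp)) _ _
    have h4 : Torus.laplacian (fun x => lam • u (lam * t) x) x = lam • Torus.laplacian (u (lam * t)) x := by
      change Torus.laplacian (lam • u (lam * t)) x = _
      exact Torus.laplacian_const_smul_apply hus lam x
    have hm := h.momentum (lam * t) (mem_univ _) x
    have e1 : lam * ν * lam = lam * lam * ν := by ring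
    rw [h1, h2, h3, h4, smul_smul, smul_smul, ← smul_add, hm, smul_add, smul_sub, smul_smul, smul_smul, e1,
      pow_two, Pi.smul_apply]
  divFree t _ x := by
    have hus : IsSmooth (u (lam * t)) := h.smooth_velocity.isSmooth_slice (mem_univ _)
    change Torus.divergence (lam • u (lam * t)) x = 0
    rw [Torus.divergence_const_smul (hus.isContDiff (by simp)), h.divFree (lam * t) (mem_univ _) x, mul_zero]

/-- Periodicity rescales: `τ ↦ τ/λ` (vendored). [folklore] -/
theorem periodic_timeRescale (hper : Function.Periodic u τ) (hl : lam ≠ 0) :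
    Function.Periodic (fun t x => lam • u (lam * t) x) (τ / lam) := by
  intro t
  funext x
  simp only
  rw [mul_add, mul_div_cancel₀ τ hl, hper]

/-- `gradNormSq (λ v) = λ² gradNormSq v` for smooth `v` (vendored). [folklore] -/
theorem gradNormSq_const_smul {v : 𝕋³ → ℝ³} (hv : IsSmooth v) (a : ℝ) :
    gradNormSq (a • v) = a ^ 2 * gradNormSq v := by
  unfold gradNormSq
  rw [← integral_const_mul]
  refine integral_congr_ae (ae_of_all _ fun x => ?_)
  dsimp only
  rw [Finset.mul_sum]
  refine Finset.sum_congr rfl fun i _ => ?_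
  rw [Torus.partialDeriv_const_smul (hv.isContDiff (by simp)), Pi.smul_apply, norm_smul, mul_pow,
    Real.norm_eq_abs, sq_abs]

/-- The mean dissipation of a periodic smooth field is the period mean of `ν‖∇u‖₂²` with POINTWISE
gradients (vendored). [folklore] -/
theorem meanDissipation_eq_period_mean (hu : Torus.IsSmoothSpaceTimeOn univ u)
    (hper : Function.Periodic u τ) (hτ : 0 < τ) :
    meanDissipation ν u = τ⁻¹ * (ν * ∫ t in (0 : ℝ)..τ, gradNormSq (u t)) := by
  rw [meanDissipation_eq_of_periodic hper hτ]
  congr 1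
  rw [← intervalIntegral.integral_const_mul]
  refine intervalIntegral.integral_congr fun t _ => ?_
  rw [gradNormSq_eq_toReal_eGradNormSq_holds (hu.isSmooth_slice (mem_univ t))]

/-- Mean energy rescales by `λ²` (vendored). [folklore] -/
theorem meanEnergy_timeRescale (hper : Function.Periodic u τ) (hτ : 0 < τ) (hl : 0 < lam) :
    meanEnergy (fun t x => lam • u (lam * t) x) = lam ^ 2 * meanEnergy u := by
  rw [meanEnergy_eq_of_periodic (periodic_timeRescale hper hl.ne') (div_pos hτ hl),
    meanEnergy_eq_of_periodic hper hτ]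
  have hsub : ∫ t in (0 : ℝ)..τ / lam, ∫ x, ‖lam • u (lam * t) x‖ ^ 2 =
      lam⁻¹ * (lam ^ 2 * ∫ t in (0 : ℝ)..τ, ∫ x, ‖u t x‖ ^ 2) := by
    have h1 : (fun t => ∫ x, ‖lam • u (lam * t) x‖ ^ 2) =
        fun t => lam ^ 2 * (fun s => ∫ x, ‖u s x‖ ^ 2) (lam * t) := by
      funext t
      simp only
      rw [← integral_const_mul]
      refine integral_congr_ae (ae_of_all _ fun x => ?_)
      dsimp only
      rw [norm_smul, mul_pow, Real.norm_eq_abs, sq_abs]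
    rw [h1, intervalIntegral.integral_const_mul,
      intervalIntegral.integral_comp_mul_left (fun s => ∫ x, ‖u s x‖ ^ 2) hl.ne', mul_zero,
      mul_div_cancel₀ τ hl.ne', smul_eq_mul]
    ring
  rw [hsub]
  field_simp

/-- Mean dissipation rescales by `λ³` (viscosity `λν`) (vendored). [folklore] -/
theorem meanDissipation_timeRescale (hu : Torus.IsSmoothSpaceTimeOn univ u) (hper : Function.Periodic u τ)
    (hτ : 0 < τ) (hl : 0 < lam) :
    meanDissipation (lam * ν) (fun t x => lam • u (lam * t) x) = lam ^ 3 * meanDissipation ν u := by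
  have hφ : ContDiff ℝ ((⊤ : ℕ∞) : WithTop ℕ∞)
      (fun z : ℝ × EuclideanSpace ℝ (Fin 3) => ((lam * z.1, z.2) : ℝ × EuclideanSpace ℝ (Fin 3))) :=
    (contDiff_const.mul contDiff_fst).prodMk contDiff_snd
  have hul : Torus.IsSmoothSpaceTimeOn univ (fun t x => lam • u (lam * t) x) :=
    (hu.comp hφ.contDiffOn (fun z _ => mk_mem_prod (mem_univ _) (mem_univ _))).const_smul lam
  rw [meanDissipation_eq_period_mean hul (periodic_timeRescale hper hl.ne') (div_pos hτ hl),
    meanDissipation_eq_period_mean hu hper hτ]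
  have hsub : ∫ t in (0 : ℝ)..τ / lam, gradNormSq (fun x => lam • u (lam * t) x) =
      lam⁻¹ * (lam ^ 2 * ∫ t in (0 : ℝ)..τ, gradNormSq (u t)) := by
    have h1 : (fun t => gradNormSq (fun x => lam • u (lam * t) x)) =
        fun t => lam ^ 2 * (fun s => gradNormSq (u s)) (lam * t) := by
      funext t
      exact gradNormSq_const_smul (hu.isSmooth_slice (mem_univ _)) lam
    rw [h1, intervalIntegral.integral_const_mul,
      intervalIntegral.integral_comp_mul_left (fun s => gradNormSq (u s)) hl.ne', mul_zero,
      mul_div_cancel₀ τ hl.ne', smul_eq_mul]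
    ring
  rw [hsub]
  field_simp

/-- LOUD AT A GIVEN VISCOSITY: `c` carries a periodic classical NS_ν orbit with budgets `(E, ε)`
(vendored). [folklore] -/
def LoudAt (S : Finset (Fin 3 → ℤ)) (ν E ε : ℝ) (c : Coeff S) : Prop :=
  ∃ (τ : ℝ) (u : ℝ → 𝕋³ → ℝ³) (p : ℝ → 𝕋³ → ℝ), 0 < τ ∧
    IsClassicalNSSolutionOn Set.univ ν (fun _ => force S c) u p ∧
    Function.Periodic u τ ∧ meanEnergy u ≤ E ∧ ε ≤ meanDissipation ν u

/-- LOUDNESS IS SCALE-COVARIANT (vendored): loud at `ν` with budgets `(E,ε)` ⇒ `λ²c` loud at `λν`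
with `(λ²E, λ³ε)`. [folklore] -/
theorem loudAt_timeRescale {S : Finset (Fin 3 → ℤ)} {E ε : ℝ} {c : Coeff S} (hl : 0 < lam)
    (h : LoudAt S ν E ε c) : LoudAt S (lam * ν) (lam ^ 2 * E) (lam ^ 3 * ε) (lam ^ 2 • c) := by
  obtain ⟨τ, u, p, hτ, hsol, hper, hE, hε⟩ := h
  refine ⟨τ / lam, fun t x => lam • u (lam * t) x, fun t x => lam ^ 2 * p (lam * t) x, div_pos hτ hl, ?_,
    periodic_timeRescale hper hl.ne', ?_, ?_⟩
  · have := timeRescale hsol lam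
    rwa [force_smul]
  · rw [meanEnergy_timeRescale hper hτ hl]
    exact mul_le_mul_of_nonneg_left hE (sq_nonneg _)
  · rw [meanDissipation_timeRescale hsol.smooth_velocity hper hτ hl]
    exact mul_le_mul_of_nonneg_left hε (pow_nonneg hl.le 3)

/-- … and conversely (vendored). [folklore] -/
theorem loudAt_iff_timeRescale {S : Finset (Fin 3 → ℤ)} {E ε : ℝ} {c : Coeff S} (hl : 0 < lam) :
    LoudAt S ν E ε c ↔ LoudAt S (lam * ν) (lam ^ 2 * E) (lam ^ 3 * ε) (lam ^ 2 • c) := by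
  refine ⟨loudAt_timeRescale hl, fun h => ?_⟩
  have h' := loudAt_timeRescale (inv_pos.2 hl) h
  have hl0 : lam ≠ 0 := hl.ne'
  have e1 : lam⁻¹ * (lam * ν) = ν := by field_simp
  have e2 : lam⁻¹ ^ 2 * (lam ^ 2 * E) = E := by field_simp
  have e3 : lam⁻¹ ^ 3 * (lam ^ 3 * ε) = ε := by field_simp
  have e4 : lam⁻¹ ^ 2 • (lam ^ 2 • c) = c := by rw [smul_smul]; field_simp; exact one_smul _ _
  rwa [e1, e2, e3, e4] at h'

variable {S : Finset (Fin 3 → ℤ)} {a E ε α : ℝ} {c : Coeff S}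

theorem mem_loud_iff_loudAt : c ∈ loud S a E ε ↔ ∃ ν : ℝ, 0 < ν ∧ ν < a ∧ LoudAt S ν E ε c :=
  Iff.rfl

/-- **Scale covariance of the loud sets**: `c ∈ LOUD^{(0,a)}(E,ε) ↔ α²c ∈ LOUD^{(0,αa)}(α²E,α³ε)`. [folklore] -/
theorem mem_loud_iff_smul_mem (hα : 0 < α) :
    c ∈ loud S a E ε ↔ α ^ 2 • c ∈ loud S (α * a) (α ^ 2 * E) (α ^ 3 * ε) := by
  rw [mem_loud_iff_loudAt, mem_loud_iff_loudAt]
  constructor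
  · rintro ⟨ν, hν, hνa, h⟩
    exact ⟨α * ν, mul_pos hα hν, mul_lt_mul_of_pos_left hνa hα,
      (loudAt_iff_timeRescale hα).1 h⟩
  · rintro ⟨ν', hν', hν'a, h⟩
    refine ⟨ν' / α, div_pos hν' hα, (div_lt_iff₀ hα).2 (by rwa [mul_comm]), ?_⟩
    rw [loudAt_iff_timeRescale (lam := α) hα, mul_div_cancel₀ ν' hα.ne']
    exact h

/-- The loud sets transform as images under the homothety `c ↦ α² c`. [folklore] -/
theorem image_smul_loud (hα : 0 < α) :
    (fun c : Coeff S => α ^ 2 • c) '' loud S a E ε = loud S (α * a) (α ^ 2 * E) (α ^ 3 * ε) := by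
  ext c'
  constructor
  · rintro ⟨c, hc, rfl⟩
    exact (mem_loud_iff_smul_mem hα).1 hc
  · intro hc'
    refine ⟨(α ^ 2)⁻¹ • c', ?_, ?_⟩
    · rw [mem_loud_iff_smul_mem hα, smul_smul, mul_inv_cancel₀ (pow_ne_zero 2 hα.ne'), one_smul]
      exact hc'
    · simp only [smul_smul, mul_inv_cancel₀ (pow_ne_zero 2 hα.ne'), one_smul]

/-- **Level transfer**: the upgrade inclusion at ceiling `a` and budgets `(E,ε)` is EQUIVALENT to the one
at ceiling `αa` and budgets `(α²E, α³ε)` (`α > 0`). [folklore] -/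
theorem upgrade_iff_scaled (hα : 0 < α) :
    loud S a E ε ⊆ closure (interior (loud S a (2 * E) (ε / 2))) ↔
      loud S (α * a) (α ^ 2 * E) (α ^ 3 * ε) ⊆
        closure (interior (loud S (α * a) (2 * (α ^ 2 * E)) (α ^ 3 * ε / 2))) := by
  set φ : Coeff S ≃ₜ Coeff S := Homeomorph.smulOfNeZero (α ^ 2) (pow_ne_zero 2 hα.ne') with hφ
  have hφ' : (φ : Coeff S → Coeff S) = fun c => α ^ 2 • c := rfl
  have h1 : φ '' loud S a E ε = loud S (α * a) (α ^ 2 * E) (α ^ 3 * ε) := by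
    rw [hφ']; exact image_smul_loud hα
  have h2 : φ '' loud S a (2 * E) (ε / 2) = loud S (α * a) (2 * (α ^ 2 * E)) (α ^ 3 * ε / 2) := by
    rw [hφ', image_smul_loud hα]; congr 1 <;> ring
  rw [← Set.image_subset_image_iff φ.injective, h1, φ.image_closure, φ.image_interior, h2]

/-- The level-`0` instance of the crux (ceiling `ν < 1`). [folklore] -/
def CruxLevelZero : Prop :=
  ∃ S₀ : Finset (Fin 3 → ℤ), ∀ S : Finset (Fin 3 → ℤ), S₀ ⊆ S → ∀ (E ε : ℝ), 0 < ε →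
    loud S 1 E ε ⊆ closure (interior (loud S 1 (2 * E) (ε / 2)))

/-- **LEVEL IS DECORATION: `RobustLoudUpgrade ↔ CruxLevelZero`.** [folklore] -/
theorem crux_iff_levelZero : RobustLoudUpgrade ↔ CruxLevelZero := by
  rw [crux_iff]
  have h0 : ceil 0 = 1 := by norm_num [ceil]
  constructor
  · rintro ⟨S₀, h⟩
    refine ⟨S₀, fun S hS E ε hε => ?_⟩
    have := h S hS E ε hε 0
    rwa [h0] at this
  · rintro ⟨S₀, h⟩
    refine ⟨S₀, fun S hS E ε hε j => ?_⟩
    have hα : 0 < ceil j := by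
      have : (0 : ℝ) < (j : ℝ) + 1 := by positivity
      exact div_pos one_pos this
    -- transport the level-0 inclusion at budgets `(E/α², ε/α³)` by `α = ceil j`
    have h' := h S hS (E / ceil j ^ 2) (ε / ceil j ^ 3) (div_pos hε (pow_pos hα 3))
    rw [upgrade_iff_scaled hα] at h'
    have e1 : ceil j * 1 = ceil j := mul_one _
    have e2 : ceil j ^ 2 * (E / ceil j ^ 2) = E := by field_simp
    have e3 : ceil j ^ 3 * (ε / ceil j ^ 3) = ε := by field_simp
    rw [e1, e2, e3] at h'
    exact h'

/-- In particular the level ceiling can be normalised away in `LOUD` itself: membership at any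
ceiling is membership at ceiling `1` of a rescaled vector with rescaled budgets. [folklore] -/
theorem mem_loud_iff_unit_ceiling (ha : 0 < a) :
    c ∈ loud S a E ε ↔ (a ^ 2)⁻¹ • c ∈ loud S 1 (E / a ^ 2) (ε / a ^ 3) := by
  rw [mem_loud_iff_smul_mem (α := a⁻¹) (inv_pos.2 ha)]
  have ha0 : a ≠ 0 := ha.ne'
  have e1 : a⁻¹ * a = 1 := by field_simp
  have e2 : a⁻¹ ^ 2 * E = E / a ^ 2 := by field_simp
  have e3 : a⁻¹ ^ 3 * ε = ε / a ^ 3 := by field_simp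
  rw [e1, e2, e3, inv_pow]

end Level


/-! ## §10 NEW A-PRIORI LAW: the VISCOSITY CEILING `ν · ε ≤ ‖f_c‖₂²/(4π²)` of loud witnesses

Energy equality over a period (`ε_actual = ⟨f_c·u⟩`) + the Poincaré–Young pairing bound
`∫⟪f,v⟫ ≤ ‖f‖₂²/(8π²ν) + (ν/2)‖∇v‖₂²` (mean-zero `f`, in tree) give `ν⟨ν‖∇u‖²⟩ ≤ ‖f_c‖₂²/(4π²)`
for EVERY periodic classical witness: loud witnesses of small forces live at small viscosity, the
level ceiling is INACTIVE below the threshold `‖f_c‖₂² < 4π² ε a` (`mem_loud_of_fnorm_sq_lt`), and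
together with the floor of §5 a loud witness's viscosity is pinned to a window determined by
`(‖f_c‖₂, ‖∇f_c‖_∞, ‖Δf_c‖₂, E, ε)`.  (For the kill question this changes nothing: small `ν'` stay
admissible for neighbours outside the low-energy regime.) -/

section Ceiling

variable {S : Finset (Fin 3 → ℤ)} {a E ε ν τ : ℝ} {c : Coeff S} {u : ℝ → 𝕋³ → ℝ³} {p : ℝ → 𝕋³ → ℝ}

/-- Energy equality over one period (vendored from the sibling work file, §3):
`ν ∫₀^τ ‖∇u‖₂² = ∫₀^τ ∫⟪f_c, u⟫`. [folklore] -/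
theorem period_dissipation_eq_power (h : IsClassicalNSSolutionOn univ ν (fun _ => force S c) u p)
    (hper : Function.Periodic u τ) (hτ : 0 < τ) :
    ν * ∫ t in (0 : ℝ)..τ, gradNormSq (u t) = ∫ t in (0 : ℝ)..τ, ∫ x, ⟪force S c x, u t x⟫_ℝ := by
  have hE := h.energy_eq convex_univ hτ.le (subset_univ _)
  have h0 : u τ = u 0 := by simpa using hper 0
  rw [h0] at hE
  linarith

/-- **VISCOSITY CEILING.** For every `τ`-periodic classical solution forced by `f_c` at viscosity
`ν > 0`: `ν · meanDissipation ν u ≤ ‖f_c‖₂² / (4π²)`. [folklore] -/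
theorem viscosity_ceiling (hν : 0 < ν) (h : IsClassicalNSSolutionOn univ ν (fun _ => force S c) u p)
    (hper : Function.Periodic u τ) (hτ : 0 < τ) :
    ν * meanDissipation ν u ≤ fnorm S c ^ 2 / (4 * Real.pi ^ 2) := by
  have hu := h.smooth_velocity
  set G : ℝ → ℝ := fun t => gradNormSq (u t) with hG
  set P : ℝ → ℝ := fun t => ∫ x, ⟪force S c x, u t x⟫_ℝ with hP
  have hGcont : Continuous G := by
    rw [← continuousOn_univ]; exact hu.continuousOn_gradNormSq convex_univ uniqueDiffOn_univ
  have hPcont : Continuous P := by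
    have hc : ContinuousOn (fun t => ∫ x, ⟪u t x, force S c x⟫_ℝ) univ :=
      hu.continuousOn_integral_inner (memLp_force c 2)
    rw [← continuousOn_univ]
    refine hc.congr fun t _ => ?_
    exact integral_congr_ae (ae_of_all _ fun x => real_inner_comm _ _)
  -- pointwise Poincaré–Young bound with `b = 4π²ν`
  have hpt : ∀ t, P t ≤ fnorm S c ^ 2 / (8 * Real.pi ^ 2 * ν) + ν / 2 * G t := fun t => by
    have hus : IsSmooth (u t) := hu.isSmooth_slice (mem_univ t)
    have hfin : eGradNormSq (u t) ≠ ∞ := (eGradNormSq_lt_top hus).ne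
    have hb : 0 < 4 * Real.pi ^ 2 * ν := by positivity
    have hy := integral_inner_le_of_hasZeroMean (memLp_force c 2) (hasZeroMean_force c) (hus.memLp 2)
      hfin hb
    rw [← gradNormSq_eq_toReal_eGradNormSq_holds hus, ← fnorm_sq] at hy
    have e1 : (4 * Real.pi ^ 2 * ν)⁻¹ / 2 * fnorm S c ^ 2 = fnorm S c ^ 2 / (8 * Real.pi ^ 2 * ν) := by
      field_simp; ring
    have e2 : 4 * Real.pi ^ 2 * ν / 2 * ((4 * Real.pi ^ 2)⁻¹ * gradNormSq (u t)) = ν / 2 * G t := by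
      simp only [hG]; field_simp
    rw [e1, e2] at hy
    exact hy
  -- integrate over a period
  set D : ℝ := ∫ t in (0 : ℝ)..τ, G t with hD
  have hint : ∫ t in (0 : ℝ)..τ, P t ≤
      ∫ t in (0 : ℝ)..τ, (fnorm S c ^ 2 / (8 * Real.pi ^ 2 * ν) + ν / 2 * G t) :=
    intervalIntegral.integral_mono_on hτ.le (hPcont.intervalIntegrable _ _)
      ((continuous_const.add (continuous_const.mul hGcont)).intervalIntegrable _ _)
      fun t _ => hpt t
  have hint2 : ∫ t in (0 : ℝ)..τ, (fnorm S c ^ 2 / (8 * Real.pi ^ 2 * ν) + ν / 2 * G t) =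
      τ * (fnorm S c ^ 2 / (8 * Real.pi ^ 2 * ν)) + ν / 2 * D := by
    rw [intervalIntegral.integral_add (f := fun _ => fnorm S c ^ 2 / (8 * Real.pi ^ 2 * ν))
        (g := fun t => ν / 2 * G t) intervalIntegrable_const
        ((continuous_const.mul hGcont).intervalIntegrable _ _),
      intervalIntegral.integral_const, intervalIntegral.integral_const_mul, sub_zero, smul_eq_mul]
  have hEq := period_dissipation_eq_power h hper hτ
  -- `ν D = ∫ P ≤ τ F²/(8π²ν) + (ν/2) D` ⇒ `ν² D ≤ τ F²/(4π²)`
  have hνD : ν * D ≤ τ * (fnorm S c ^ 2 / (8 * Real.pi ^ 2 * ν)) + ν / 2 * D := by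
    rw [hD, hEq]; exact hint.trans hint2.le
  have hmd : meanDissipation ν u = τ⁻¹ * (ν * D) := meanDissipation_eq_period_mean hu hper hτ
  rw [hmd]
  have hkey : ν * (ν * D) ≤ τ * (fnorm S c ^ 2 / (4 * Real.pi ^ 2)) := by
    have h2 : ν * (ν * D) ≤ 2 * (ν * (τ * (fnorm S c ^ 2 / (8 * Real.pi ^ 2 * ν)))) := by nlinarith
    calc ν * (ν * D) ≤ 2 * (ν * (τ * (fnorm S c ^ 2 / (8 * Real.pi ^ 2 * ν)))) := h2
      _ = τ * (fnorm S c ^ 2 / (4 * Real.pi ^ 2)) := by field_simp; ring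
  calc ν * (τ⁻¹ * (ν * D)) = τ⁻¹ * (ν * (ν * D)) := by ring
    _ ≤ τ⁻¹ * (τ * (fnorm S c ^ 2 / (4 * Real.pi ^ 2))) :=
        mul_le_mul_of_nonneg_left hkey (inv_nonneg.2 hτ.le)
    _ = fnorm S c ^ 2 / (4 * Real.pi ^ 2) := by field_simp

/-- **On `LOUD` the witness viscosity obeys `ν ε ≤ ‖f_c‖₂²/(4π²)`.** [folklore] -/
theorem loudAt_viscosity_le (hν : 0 < ν) (hε : 0 < ε) (h : LoudAt S ν E ε c) :
    ν ≤ fnorm S c ^ 2 / (4 * Real.pi ^ 2 * ε) := by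
  obtain ⟨τ, u, p, hτ, hsol, hper, -, hεu⟩ := h
  have hc := viscosity_ceiling hν hsol hper hτ
  have h1 : ν * ε ≤ fnorm S c ^ 2 / (4 * Real.pi ^ 2) :=
    (mul_le_mul_of_nonneg_left hεu hν.le).trans hc
  rw [le_div_iff₀ (by positivity)]
  calc ν * (4 * Real.pi ^ 2 * ε) = (ν * ε) * (4 * Real.pi ^ 2) := by ring
    _ ≤ fnorm S c ^ 2 / (4 * Real.pi ^ 2) * (4 * Real.pi ^ 2) :=
        mul_le_mul_of_nonneg_right h1 (by positivity)
    _ = fnorm S c ^ 2 := by field_simp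

/-- **LEVEL CEILING INACTIVE FOR SMALL FORCES**: if `‖f_c‖₂² < 4π² ε a'` then loudness of `c` at ANY
ceiling `a` implies loudness at ceiling `a'` — the witness automatically lives below `a'`. [folklore] -/
theorem mem_loud_of_fnorm_sq_lt {a' : ℝ} (hε : 0 < ε) (hsmall : fnorm S c ^ 2 < 4 * Real.pi ^ 2 * ε * a')
    (h : c ∈ loud S a E ε) : c ∈ loud S a' E ε := by
  rw [mem_loud_iff_loudAt] at h ⊢
  obtain ⟨ν, hν, -, hl⟩ := h
  refine ⟨ν, hν, ?_, hl⟩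
  have hνle := loudAt_viscosity_le hν hε hl
  calc ν ≤ fnorm S c ^ 2 / (4 * Real.pi ^ 2 * ε) := hνle
    _ < a' := by rw [div_lt_iff₀ (by positivity)]; linarith

end Ceiling


/-! ## §11 Lattice-translation (phase) invariance of `LOUD` and of its interior (NEW; serves the
crux cards' `loud_translate`)

The torus acts on `P_S` by phases, `(b · c) k = e_k(b) c k`, and `f_{b·c} = f_c(· + b)`; translating a
classical witness in space is again a witness with the same budgets.  Hence `LOUD`, `interior LOUD`
and `closure (interior LOUD)` are unions of `T³`-orbits (`mem_loud_iff_phase`,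
`mem_interior_loud_iff_phase`, `mem_closure_interior_loud_iff_phase`): the upgrade obligation at `c`
is the same at every translate of `c`, symmetric (sub-lattice) forces have continuous isotropy, and
NO confinement of `LOUD` to a slice of an orbit is possible (another dead kill template). -/

section Translate

open UnitAddTorus

variable {S : Finset (Fin 3 → ℤ)}

/-- The phase action of `b ∈ T³` on coefficient vectors. [folklore] -/
def phase (b : 𝕋³) (c : Coeff S) : Coeff S := fun k => mFourier (k : Fin 3 → ℤ) b • c k

theorem coeffExt_phase (b : 𝕋³) (c : Coeff S) (k : Fin 3 → ℤ) :
    coeffExt S (phase b c) k = mFourier k b • coeffExt S c k := by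
  by_cases hk : k ∈ S
  · rw [coeffExt_of_mem _ hk, coeffExt_of_mem _ hk]; rfl
  · rw [coeffExt_of_not_mem _ hk, coeffExt_of_not_mem _ hk, smul_zero]

/-- **`f_{b·c} = f_c(· + b)`.** [folklore] -/
theorem force_phase (b : 𝕋³) (c : Coeff S) : force S (phase b c) = fun y => force S c (y + b) := by
  funext y
  rw [force, force, realTrigPoly_apply, realTrigPoly_apply, trigPoly_apply, trigPoly_apply]
  congr 1
  refine Finset.sum_congr rfl fun k _ => ?_
  rw [coeffExt_phase, lerayCoeff_smul, smul_smul, mFourier_apply_add]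

theorem phase_phase (b b' : 𝕋³) (c : Coeff S) : phase b (phase b' c) = phase (b + b') c := by
  funext k
  simp only [phase, smul_smul, mFourier_apply_add]

theorem mFourier_apply_zero (k : Fin 3 → ℤ) : mFourier k (0 : 𝕋³) = 1 := by
  simp [mFourier]

theorem phase_zero (c : Coeff S) : phase 0 c = c := by
  funext k
  simp only [phase, mFourier_apply_zero, one_smul]

theorem phase_neg_phase (b : 𝕋³) (c : Coeff S) : phase (-b) (phase b c) = c := by
  rw [phase_phase, neg_add_cancel, phase_zero]

theorem continuous_phase (b : 𝕋³) : Continuous (phase (S := S) b) :=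
  continuous_pi fun k => (continuous_const (y := mFourier (k : Fin 3 → ℤ) b)).smul (continuous_apply k)

/-- The phase action as a homeomorphism of `P_S`. [folklore] -/
def phaseHomeo (b : 𝕋³) : Coeff S ≃ₜ Coeff S where
  toFun := phase b
  invFun := phase (-b)
  left_inv := phase_neg_phase b
  right_inv := fun c => by
    have := phase_neg_phase (-b) c
    rwa [neg_neg] at this
  continuous_toFun := continuous_phase b
  continuous_invFun := continuous_phase (-b)

/-! ### Space translation of classical solutions on the torus -/

theorem liftAt_comp_add_right' {F : Type*} (f : 𝕋³ → F) (b x : 𝕋³) :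
    liftAt (fun y => f (y + b)) x = liftAt f (x + b) := by
  funext v
  simp only [liftAt_apply, add_right_comm]

theorem laplacian_comp_add_right' {F : Type*} [NormedAddCommGroup F] [InnerProductSpace ℝ F]
    (f : 𝕋³ → F) (b x : 𝕋³) : Torus.laplacian (fun y => f (y + b)) x = Torus.laplacian f (x + b) := by
  simp only [Torus.laplacian, liftAt_comp_add_right']

theorem gradient_comp_add_right' (f : 𝕋³ → ℝ) (b x : 𝕋³) :
    Torus.gradient (fun y => f (y + b)) x = Torus.gradient f (x + b) := by
  simp only [Torus.gradient, liftAt_comp_add_right']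

theorem fderiv_comp_add_right' {F : Type*} [NormedAddCommGroup F] [NormedSpace ℝ F] (f : 𝕋³ → F)
    (b x : 𝕋³) : Torus.fderiv (fun y => f (y + b)) x = Torus.fderiv f (x + b) := by
  simp only [Torus.fderiv, liftAt_comp_add_right']

theorem convect_comp_add_right' {F : Type*} [NormedAddCommGroup F] [NormedSpace ℝ F] (u : 𝕋³ → ℝ³)
    (v : 𝕋³ → F) (b x : 𝕋³) :
    Torus.convect (fun y => u (y + b)) (fun y => v (y + b)) x = Torus.convect u v (x + b) := by
  simp only [Torus.convect, fderiv_comp_add_right']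

theorem partialDeriv_comp_add_right' {F : Type*} [NormedAddCommGroup F] [NormedSpace ℝ F] (i : Fin 3)
    (f : 𝕋³ → F) (b x : 𝕋³) : partialDeriv i (fun y => f (y + b)) x = partialDeriv i f (x + b) := by
  simp only [Torus.partialDeriv, Torus.lineDeriv, add_right_comm]

theorem divergence_comp_add_right' (u : 𝕋³ → ℝ³) (b x : 𝕋³) :
    divergence (fun y => u (y + b)) x = divergence u (x + b) := by
  simp only [divergence]
  refine Finset.sum_congr rfl fun i _ => ?_
  exact partialDeriv_comp_add_right' i (fun y => u y i) b x

theorem isSmoothSpaceTimeOn_comp_add_right {F : Type*} [NormedAddCommGroup F] [NormedSpace ℝ F]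
    {T : Set ℝ} {u : ℝ → 𝕋³ → F} (hu : Torus.IsSmoothSpaceTimeOn T u) (b : 𝕋³) :
    Torus.IsSmoothSpaceTimeOn T (fun t y => u t (y + b)) := by
  obtain ⟨w, rfl⟩ := proj_surjective b
  have hst : stLift (fun t y => u t (y + proj w)) =
      stLift u ∘ fun z : ℝ × EuclideanSpace ℝ (Fin 3) => (z.1, z.2 + w) := by
    funext z
    simp only [Function.comp_apply, stLift, proj_add]
  unfold Torus.IsSmoothSpaceTimeOn at hu ⊢
  rw [hst]
  refine hu.comp ((contDiff_fst.prodMk (contDiff_snd.add contDiff_const)).contDiffOn) ?_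
  rintro ⟨t, y⟩ hz
  exact mk_mem_prod (mem_prod.1 hz).1 (mem_univ _)

/-- **Space translation of a classical solution** (steady force): `(u,p)(t, · + b)` solves NS_ν forced
by `f(· + b)`. [folklore] -/
theorem translate_isClassical {ν : ℝ} {f : 𝕋³ → ℝ³} {u : ℝ → 𝕋³ → ℝ³} {p : ℝ → 𝕋³ → ℝ}
    (h : IsClassicalNSSolutionOn univ ν (fun _ => f) u p) (b : 𝕋³) :
    IsClassicalNSSolutionOn univ ν (fun _ y => f (y + b)) (fun t y => u t (y + b))
      (fun t y => p t (y + b)) where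
  smooth_velocity := isSmoothSpaceTimeOn_comp_add_right h.smooth_velocity b
  smooth_pressure := isSmoothSpaceTimeOn_comp_add_right h.smooth_pressure b
  momentum t _ x := by
    have hm := h.momentum t (mem_univ _) (x + b)
    have h1 : Torus.timeDerivWithin univ (fun t y => u t (y + b)) t x =
        Torus.timeDerivWithin univ u t (x + b) := rfl
    rw [h1, convect_comp_add_right', laplacian_comp_add_right', gradient_comp_add_right']
    exact hm
  divFree t _ x := by
    rw [divergence_comp_add_right']
    exact h.divFree t (mem_univ _) (x + b)

/-- Mean energy is translation invariant. [folklore] -/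
theorem meanEnergy_translate (u : ℝ → 𝕋³ → ℝ³) (b : 𝕋³) :
    meanEnergy (fun t y => u t (y + b)) = meanEnergy u := by
  rw [meanEnergy_eq_longTimeAvgSup, meanEnergy_eq_longTimeAvgSup]
  congr 1
  funext t
  exact integral_add_right_eq_self (μ := (volume : Measure 𝕋³)) (fun y => ‖u t y‖ ^ 2) b

/-- `gradNormSq` is translation invariant. [folklore] -/
theorem gradNormSq_translate (v : 𝕋³ → ℝ³) (b : 𝕋³) :
    gradNormSq (fun y => v (y + b)) = gradNormSq v := by
  unfold gradNormSq
  have h : (fun x => ∑ i, ‖partialDeriv i (fun y => v (y + b)) x‖ ^ 2) =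
      fun x => (fun z => ∑ i, ‖partialDeriv i v z‖ ^ 2) (x + b) := by
    funext x
    simp only [partialDeriv_comp_add_right']
  rw [h]
  exact integral_add_right_eq_self (μ := (volume : Measure 𝕋³)) (fun z => ∑ i, ‖partialDeriv i v z‖ ^ 2) b

/-- Mean dissipation of a jointly smooth field is translation invariant. [folklore] -/
theorem meanDissipation_translate {ν : ℝ} {u : ℝ → 𝕋³ → ℝ³} (hu : Torus.IsSmoothSpaceTimeOn univ u) (b : 𝕋³) :
    meanDissipation ν (fun t y => u t (y + b)) = meanDissipation ν u := by
  unfold meanDissipation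
  congr 1
  funext t
  have hs : IsSmooth (u t) := hu.isSmooth_slice (mem_univ t)
  have hsb : IsSmooth (fun y => u t (y + b)) := hs.comp_add_right b
  rw [← gradNormSq_eq_toReal_eGradNormSq_holds hs, ← gradNormSq_eq_toReal_eGradNormSq_holds hsb,
    gradNormSq_translate]

variable {a E ε : ℝ} {c : Coeff S}

/-- **`LOUD` is a union of `T³`-orbits**: `c ∈ LOUD ↔ b·c ∈ LOUD`. [folklore] -/
theorem mem_loud_iff_phase (b : 𝕋³) : c ∈ loud S a E ε ↔ phase b c ∈ loud S a E ε := by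
  suffices key : ∀ (b : 𝕋³) (c : Coeff S), c ∈ loud S a E ε → phase b c ∈ loud S a E ε by
    refine ⟨key b c, fun h => ?_⟩
    have := key (-b) _ h
    rwa [phase_neg_phase] at this
  intro b c hc
  obtain ⟨ν, hν, hνa, τ, u, p, hτ, hsol, hper, hE, hε⟩ := hc
  refine ⟨ν, hν, hνa, τ, fun t y => u t (y + b), fun t y => p t (y + b), hτ, ?_, fun t => ?_, ?_, ?_⟩
  · rw [force_phase]; exact translate_isClassical hsol b
  · funext y; simp only [hper t]
  · rwa [meanEnergy_translate]
  · rwa [meanDissipation_translate hsol.smooth_velocity]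

theorem image_phase_loud (b : 𝕋³) : phase b '' loud S a E ε = loud S a E ε := by
  ext c'
  constructor
  · rintro ⟨c, hc, rfl⟩; exact (mem_loud_iff_phase b).1 hc
  · intro hc'
    refine ⟨phase (-b) c', (mem_loud_iff_phase (-b)).1 hc', ?_⟩
    have := phase_neg_phase (-b) c'
    rwa [neg_neg] at this

theorem preimage_phase_loud (b : 𝕋³) : phase b ⁻¹' loud S a E ε = loud S a E ε := by
  ext c
  exact (mem_loud_iff_phase b).symm

/-- **`interior LOUD` is `T³`-invariant.** [folklore] -/
theorem mem_interior_loud_iff_phase (b : 𝕋³) :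
    phase b c ∈ interior (loud S a E ε) ↔ c ∈ interior (loud S a E ε) := by
  have h := (phaseHomeo (S := S) b).preimage_interior (loud S a E ε)
  rw [show ((phaseHomeo (S := S) b) : Coeff S → Coeff S) = phase b from rfl, preimage_phase_loud] at h
  rw [← Set.mem_preimage, h]

/-- **`closure (interior LOUD)` is `T³`-invariant**: the upgrade obligation is constant along orbits. [folklore] -/
theorem mem_closure_interior_loud_iff_phase (b : 𝕋³) :
    phase b c ∈ closure (interior (loud S a E ε)) ↔ c ∈ closure (interior (loud S a E ε)) := by
  have h := (phaseHomeo (S := S) b).preimage_closure (interior (loud S a E ε))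
  rw [(phaseHomeo (S := S) b).preimage_interior, show ((phaseHomeo (S := S) b) : Coeff S → Coeff S) = phase b
    from rfl, preimage_phase_loud] at h
  rw [← Set.mem_preimage, h]

end Translate

/-!
## VERDICT (generation 3, cycle 2; file v6) — the crux RESISTS; why, precisely

(K-shape) By `not_crux_iff` / `not_mem_closure_interior_of_dense_compl`, a kill needs, for every
stock `S₀`, a loud `c ∈ LOUD(S,E,ε)` and an open `V ∋ c` in `P_S` on which RELAXED-QUIET forces are
dense: for a dense set of `c' ∈ V`, at EVERY `ν ∈ (0, 1/(j+1))`, EVERY time-periodic classical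
solution forced by `f_{c'}` has mean energy `> 2E` or mean dissipation `< ε/2`.  That is a
uniform-in-`ν` census of ALL periodic orbits (steady states included — they exist at every `ν` by
Leray–Schauder) for an open-dense set of generic 3-D trigonometric-polynomial forces: a negative
zeroth-law theorem restricted to periodic orbits.  Nothing of the kind is in print or in the tree.

(K-apriori) A-priori regions cannot do it: every necessary condition for loudness that is
continuous in `(c', ν', E', ε')` (power bound §3; the Doering–Foias budget law
`‖f‖₂² ≤ ‖∇f‖_∞·E + ν‖Δf‖₂ √E`, generation 2) is satisfied at `(c, ν₀, E_c, ε_c)` by `c`'s own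
witness, hence — after the factor-2 relaxation — on a neighbourhood of `(c, ν₀)`: the admissible
region always contains the data of nearby forces.  (Sharp budgets ARE separable: `not_mem_loud_of_power_lt`.)

(K-window) The budget law confines relaxed-loud witnesses of neighbours to `ν' ≥ ν_min(c') :=
(‖f‖₂² − 2‖∇f‖_∞·2E)/(‖Δf‖₂ √(2·2E))` only in the LOW-ENERGY regime `E < ‖f‖₂²/(4‖∇f‖_∞)`; there the
census is a compact problem (`ν' ∈ [ν_min, 1)`), but `c`'s own witness lives at `ν₀ ≥ √2·ν_min`
(same law, sharp budgets), i.e. at Grashof number at most HALF that of the neighbours' admissible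
floor; whenever `(c', ν_min)` is in the small-Grashof uniqueness regime so is `(c, ν₀)`, the loud
witness of `c` is the unique (globally attracting) steady state, it continues real-analytically in
`(c', ν')`, and `c ∈ interior LOUD(2E, ε/2)` — NO kill.  Outside the uniqueness regime no census of
periodic orbits of 3-D NS is available for any open set of forces.  So the only conceivable kill is
an ISOLA CENTRE (a loud orbit non-continuable in all `2|S|+1` directions `(c', ν')`, expected
codimension `−1`, generation 2 §6(vi)) sitting at moderate Grashof inside the low-energy window,
PLUS a computer-assisted census there — no candidate force is known.

(K-ceiling) NEW law (§10): `ν ≤ ‖f_c‖₂²/(4π²ε)` for every loud witness (energy equality over a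
period + Poincaré–Young against the mean-zero force).  With the floor (§5, low-energy regime only)
the witness viscosity of `c` is pinned to `[(‖f‖²−C E)/(K√E), ‖f‖²/(4π²ε)]`; for the kill question it
is neutral (it removes LARGE `ν'`, never small ones), but it shows the level structure of `LOUD` is
invisible on `{‖f_c‖₂² < 4π²ε/(j+1)}` and gives provers the Grashof window a witness must occupy.

(K-lit) Literature (zbMATH + held books, 2026-08-15; searchd/OpenAlex/S2 degraded): the positive
genericity results are Foias–Temam 1976 (LNM 565 pp. 24–25, READ: dense `G_δ` of forces in `H`;
finite-mode version needs `m ≥ m₁(k,ν)` because it rests on the slaving `Q_m u = Φ(P_m u)`), Foias–Temam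
1977, Saut–Temam 1980 (Indiana 29: genericity w.r.t. boundary values), Saut 1983; NO published family
of finite-mode forces where force-openness of loudness fails; the degenerate scenarios in print are
symmetric continua (Iudovich/Meshalkin–Sinai Kolmogorov bifurcation; Chen–Price 2006 'circle
bifurcations', JMAA 324) — trivial-branch bifurcations and folds in `ν`, both harmless here because
the laminar branch persists and `ν` is free; numerical UPO continuations (Parker–Schneider 2022 JFM
941; Cleary–Page 2025 JFM 1020; van Veen–Kida–Kawahara) show folds/period-doublings, never isolas in
the full force family.

(K-lin) Exact obstructions (templates §4) would bypass the census; the only natural one (nonzero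
mean force ⇒ no periodic orbits) is killed by `hasZeroMean_force`; Galilean boosts act on `u`, not
on `c`, and only ADD energy at equal dissipation; lattice translations act on `P_S` by phases and
preserve `LOUD`, its interior and the obligation (§11, `mem_closure_interior_loud_iff_phase`), so no
confinement to a slice of an orbit either.

(K-hyp) Load-bearing hypotheses: `0 < ε` (dropping it: `LOUD(S,0,0) ⊆ ker (c ↦ f_c)`, a proper
closed subspace ∋ 0 — `crux_false_without_pos_budget`, §8); the factor-2 relaxation (sharp budgets:
`LOUD` not open along the laminar ray, `not_isOpen_loud`, §6); the level `j` is decoration (NS time-rescaling `(u,p,ν,f) ↦ (αu(α·),α²p(α·),αν,α²f)`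
maps `LOUD^{(0,a)}(E,ε)` onto `LOUD^{(0,αa)}(α²E,α³ε)` along `c ↦ α²c`).

(K-toy) The abstract continuation/degree skeleton alone cannot PROVE the crux either (generation 2
§8: polynomial state equation with `LOUD(1) = LOUD(2) = {0}`), so NS-specific global input is needed
on the positive side — but its absence is not a refutation.
-/

end Summit.AnomalousDissipation.AnomalousDissipation.Cruxes.RobustLoudUpgrade.Disproof
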